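import Summits.BirchSwinnertonDyer.BirchSwinnertonDyer.Theses.ErratumRoadFive
import Summits.BirchSwinnertonDyer.BirchSwinnertonDyer.Theses.PrintX11a
import Summits.BirchSwinnertonDyer.Rank1Residual.X11a.Cells
import Summits.BirchSwinnertonDyer.BirchSwinnertonDyer.Theorems.PrintX11aLowerHalfOddPrimeStub
import Summits.BirchSwinnertonDyer.BirchSwinnertonDyer.Theorems.PrintX11aLowerHalfThreeKodairaMemberByName
import Summits.BirchSwinnertonDyer.BirchSwinnertonDyer.Theorems.PrintX11aLowerHalfNonSurjDoors
import Summits.BirchSwinnertonDyer.BirchSwinnertonDyer.Theorems.PrintX11aLowerHalfBodyOfContraFacts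
import Summits.BirchSwinnertonDyer.BirchSwinnertonDyer.Theorems.PrintX11aLowerHalfThreePartnerContra
import Summits.BirchSwinnertonDyer.BirchSwinnertonDyer.Theorems.PrintX11aLowerHalfPartnerThree
import Summits.BirchSwinnertonDyer.BirchSwinnertonDyer.Theorems.PrintX11aLowerHalfTresRamifieCore
import Summits.BirchSwinnertonDyer.BirchSwinnertonDyer.Theorems.PrintX11aLowerHalfThreePartnerTheoremB
import Summits.BirchSwinnertonDyer.BirchSwinnertonDyer.Theorems.PrintX11aLowerHalfThreeMazurCore
import Summits.BirchSwinnertonDyer.BirchSwinnertonDyer.Theorems.PrintX11aLowerHalfOfChildrenMuFive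
import Summits.BirchSwinnertonDyer.BirchSwinnertonDyer.Theorems.PrintX11aLowerHalfOfChildrenMazurFive
import Summits.BirchSwinnertonDyer.BirchSwinnertonDyer.Theorems.PrintX11aLowerHalfAtThreeOfChildren
import Summits.BirchSwinnertonDyer.BirchSwinnertonDyer.Theorems.PrintX11aLowerHalfFiveOfGreenbergRankZero
import Summits.BirchSwinnertonDyer.Rank1Residual.X11a.BaseChangeRoute
import Literature.NumberTheory.EllipticCurves.Wuthrich2014.ThreeAdicImageSupersingularProofs
import HarnessLib

/-!
# Line «birth» for the crux `X11aLowerHalf` (item stmt-BirchSwinnertonDyer-19064; routes `ErratumRoadFive`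
# rank 5 / `PrintX11a` rank 2 — ONE statement under two route names, `Iff.rfl`)

RESHAPE r20 — REGISTERED by LEAD bsd-line-x11a-p1 g21 (2026-08-29T14:2xZ, `ledger skeleton check` + `crux write`; text = width seat
bsd-line-er5-p2 g25's draft of 13:1xZ, sha16 1beafde4d162728e, adopted verbatim but for this sentence), «VARIANT-N: the five print facts become ONE declared CITE stub» per director-bsd g18 RESTUB SHAPE OF RECORD (REQUESTS.md (390)(i)–(iii),
cell INBOX 2026-08-29T12:57:06Z; (385)(2)/(387) RESTUB WAVE): the registry REFUSES a bare Literature named fact as a hypothesis of a registered `<Crux>_of`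
(`skeleton.extra-hypothesis` — machine-checked for THIS crux by er5-p2 g25's probes A–D, evidence #60 `RESTUB-MECHANICS-19064-g25.md`: Literature-decl and
∀-guarded fact binders bounce, route-ITEM spellings pass), so «all print facts a skeleton needs = conjuncts of ONE declared cite stub with the Literature decls BY
NAME inside, [CITE-ONLY — never a proof target, never benched]».  r20 therefore MERGES r19's five one-fact stubs into `stub_printInputsLower :
exists_isNewformOf ∧ G104 ∧ G103 ∧ rank_eq_analyticRank_of_analyticRank_le_one ∧ (∀ W p, p ≠ 2 → greenberg_stevens)` (conjunct order = p666636 §4's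
argument order) and keeps the five r19 NAMES as sorry-free PROJECTION THEOREMS (`stub_newformFact := stub_printInputsLower.1`, …), so the composition
`X11aLowerHalf_of` and every history theorem below are BYTE-IDENTICAL to r19.  REPORT tokens ((390), one per print-touched stub): `stub_newformFact` PURE-CITE ·
`stub_greenbergSplitRankZero` PURE-CITE · `stub_greenbergNonsplitRankZero` PURE-CITE · `stub_gzkFactLower` PURE-CITE · `stub_greenbergStevensOdd` PURE-CITE (all five →
the cite stub) · `stub_mazurMCAtDeepFive` CONTENT (unchanged; benchable) · `stub_x11aLowerHalfAtThree` CONTENT (= item 23178; unchanged).  No MIXED stub on this line.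
Registered stubs after r20 (3): `stub_mazurMCAtDeepFive` (research, OPEN) | `stub_x11aLowerHalfAtThree` (= item 23178) | `stub_printInputsLower` (CITE-ONLY, 5
conjuncts).  Sorries 7 → 3; named published facts on the line 5 (unchanged); research statements 1; items-by-text 1 (+ two inside the cite stub: 19382, 19921).
READING per (390)(iii): L is NOT «closed mod print» — two CONTENT stubs remain (MC5, 23178); it reads «mod print {exists_isNewformOf, G104, G103, GZK, GS-odd} +
MC5 + 23178», consistent with director (386) (19064 EXCLUDED as a named residual).  W-81′ turnkey unchanged (p666636 §4: `… C_23178 C_19382 C_G104 C_G103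
C_19921 C_GSodd C_MC5`; a planner bundle item `PrintFactsX11aLower` would feed `C_19382 … C_GSodd` by projections).  Nothing provable added or removed; nothing
is asserted about any curve; BSD is not proved by any of this.

RESHAPE r19 (lead gen 12 = prover-bsd-line-x11a-p1-g12-0, 2026-08-28T22:2xZ REGISTERED, «L's own facts, ONE PER STUB, Greenberg-typed — the shared nine leave
L's line»): the ONE event since g11 is the INPUTS desk's grading (pub/bsd-wall/bsd-inputs/INPUTS-LIST-2-ADDENDUM-37.md §G, 21:38:37Z; REF g21
READ ✓ 21:38:53Z, U.26 resolved): Greenberg's two rank-`0` "analogue of theorem 4.1" facts (LNM 1716 §4) are now REGISTERED rows **G103**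
`Greenberg1999.thm41Analogue_charValue_rankZero_numberField` (D-audit FAITHFUL-as-weakening) ∕ **G104**
`Greenberg1999.thm41Analogue_charValue_rankZero_split_baseChange_anyPrime` (FAITHFUL-as-specialisation), they DOMINATE Stein–Wuthrich 2013
Thm. 6.1 ×2 on this rank-`0` class (SW 6.1 is typed for every rank; at `r ≥ 1` it rests on Jones 1989 Thm. 3.1, primary UNHELD acq-07893/14254;
its `r = 0` slices are tree THEOREMS from exactly G104 ∕ G103, p662964 ∕ p664420), and «an r19 re-cut SW 6.1 ↦ G104 ∕ G103 is INPUTS-positive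
(−1 unheld XL print dependency in the `_holds` cone, +0 named facts)».  g9 had conditioned r19 on that grading (cell bus 20:42:23Z); g12 rules
**r19**: (1) the `p ≥ 5` road of L is width seat er5-p2 g14's p666636 `Theorems.GreenbergRankZero.x11aLowerHalf_of_lowerAtThree_of_mazurMCAtDeepFive_of_greenberg_of_threeFacts
(hA) (hNf) (hGs) (hGn) (hGZK) (hGS) (hMC5) : Theses.PrintX11a.X11aLowerHalf` (REF V103 PASS) — Mazur's statement at the deep pairs through the
Greenberg-typed five-fact door (modularity, G104, G103, GZK, Greenberg–Stevens at odd `p`); (2) the facts L ACTUALLY reads are therefore FIVE —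
`exists_isNewformOf`, G104, G103, `rank_eq_analyticRank_of_analyticRank_le_one`, GS at odd primes — and r19 displays them ONE PER STUB
(`stub_newformFact` | `stub_greenbergSplitRankZero` | `stub_greenbergNonsplitRankZero` | `stub_gzkFactLower` | `stub_greenbergStevensOdd`), the
shape U5's line gl1cartan5 rev 5–8 uses (`stub_rankFact` ∕ `stub_newform` ∕ `stub_maninOdd`, REF POLICE EQUAL): each closes BY INSTANTIATION the
moment its `_holds` lands, two are EXISTING items by text (19921 GZK; 19382 `exists_isNewformOf`), two are shared verbatim with U5's registered stubs
(`stub_rankFact`, `stub_newform`) and four with U3's finemu3 r7 (newform, GS-odd, G104, G103); (3) the SHARED NINE `stub_nineFactsOddGS` LEAVES L's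
skeleton: five of its conjuncts (Kato 12.4, Kato §17.13 V′ ∕ VI′ ∕ XI′, Mazur Cor. 4.1) were never read by L's composition — they rode on L only so
that ONE planner item could feed U3 ∕ U5 ∕ L (r10, when U5's finemu5 shared the text; U5's line of record is gl1cartan5 since 17:12Z) — and with
them on the registered stub L's by-name closure would have waited on Kato's Euler-system `_holds`, which the LOWER half does not use.  NOT monotone
in the r15–r18 sense (SW 6.1 does not imply G103 ∕ G104); instead the r18 road is KEPT in the tree — the lead's landed four-children theorem
`Theorems.Birth.x11aLowerHalf_of_lowerAtThree_of_children_r18` (p663752; turnkey `… C_23178 C_nine C_19921 C_MC5` unchanged), so a planner who files the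
SW-typed nine still closes L through it — no road is lost; the history theorems that unpacked the nine now take it (or Mazur Cor. 4.1) as a hypothesis.  Registered stubs after r19
(7 = stubs_max): `stub_mazurMCAtDeepFive` (r17 text; THE research statement, OPEN) | `stub_x11aLowerHalfAtThree` (= item 23178) |
`stub_gzkFactLower` (= item 19921) | `stub_newformFact` (= item 19382's body) | `stub_greenbergStevensOdd` (Kobayashi 2006 Cor. 4.2, odd `p`) |
`stub_greenbergSplitRankZero` (G104) | `stub_greenbergNonsplitRankZero` (G103).  Named published facts on L's line 10 → 5; research statements 1
(unchanged); items-by-text 2 → 3.  W-81′ turnkey: `X11aLowerHalf_holds := Theorems.GreenbergRankZero.x11aLowerHalf_of_lowerAtThree_of_mazurMCAtDeepFive_of_greenberg_of_threeFacts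
C_23178 C_19382 C_G104 C_G103 C_19921 C_GSodd C_MC5`.  U3's finemu3 is re-cut in the same currency (r7, lead file
`Theorems/PrintX11aUpperNonSurjThreeOfGreenbergRankZero.lean`).  CELL READING: L = (item 23178) ∧ (ONE named open statement: Mazur's cyclotomic
main conjecture at the deep X11a pairs with `p ≥ 5`) ∧ five printed facts; nothing is asserted about any curve; BSD is not proved by any of this.

RESHAPE r18 (lead gen 9 = prover-bsd-line-x11a-p1-g9-0, 2026-08-28T20:37:11Z REGISTERED (announced on the cell bus 19:58Z, REF g21 no-objection 20:03:59Z; helper p663752 ✓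
`Theorems/PrintX11aLowerHalfAtThreeOfChildren.lean`), «the `p = 3` child IS item 23178 — stub ≡ item»): at 19:11Z planner bsd-stepL g42
(RULING 73 (d)) filed item **stmt-BirchSwinnertonDyer-23178 `X11aLowerHalfAtThree`** on routes `ClassRecordThree` ∕ `KolyvaginRoadThree` with the
text `∀ V, ClassX11a V 3 → Typed.MissingLowerBoundAt V 3` — crux L READ AT `p = 3` (= the registered stub `stub_x11aLowerHalfAtThree` of crux 19109's
line inert r20), «so that the two halves of 19064 live where they are consumed» (bsd-stepL's crux 19715 consumes only the `p ≥ 5` restriction of L,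
er5-p1 g4 p657101; cruxes 19109 ∕ 21420 consume only `p = 3`).  r18 keys L's `p = 3` side to THAT ITEM, exactly as r5–r15 keyed the non-surjective
`p ≥ 5` side to K2's item 19948: the two `p = 3` children of r17 (`stub_mazurMCAtTresRamifieThree`, Mazur's cyclotomic main conjecture at the
très-ramifié deep X11a pairs at `3` — OPEN —, and `stub_threePartnerFactsLower`, the three partner facts of the finite-flat road) and Kato–Wuthrich A32
(conjunct 1 of `stub_katoGZKFactsLower`, consumed only by the finite-flat partner road at `3`) LEAVE the skeleton and become ONE stub
`stub_x11aLowerHalfAtThree : ∀ V, ClassX11a V 3 → MissingLowerBoundAt V 3` (item 23178's text VERBATIM); `stub_katoGZKFactsLower` (A32 ∧ GZK) is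
re-cut to `stub_gzkFactLower : rank_eq_analyticRank_of_analyticRank_le_one` (Gross–Zagier–Kolyvagin alone = the body of route `PrintX11a`'s input
item 19921 `RankEqAnalyticRankLeOne`); `stub_mazurMCAtDeepFive` and `stub_nineFactsOddGS` are UNCHANGED.  The composition `X11aLowerHalf_of` becomes
the lead's `Theorems.Birth.x11aLowerHalf_erratumRoadFive_of_lowerAtThree_of_children_r18` applied to the FOUR stubs BY NAME: unit pairs free; `p = 3`
⟵ item 23178's text (the literal-prime text and the cell's guarded binder `∀ W p, ClassX11a W p → p = 3 → ¬ X11a.ShaAnUnit W p → …` are EQUIVALENT,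
`Theorems.Birth.lowerAtThree_iff_threeDeep`, pure logic); `p ≥ 5` ⟵ `stub_mazurMCAtDeepFive` through p646859's five-fact door (modularity,
Stein–Wuthrich 6.1 ×2 and Greenberg–Stevens from the nine, GZK) exactly as r17.  WHY (numbers): (1) MONOTONE — r17's five children ⟹ r18's four:
the new stub is r17's `p = 3` branch VERBATIM (`stub_x11aLowerHalfAtThree_of_r17` below, a THEOREM with A32, the three partner facts and the r17
`p = 3` text as hypotheses; = `Theorems.Birth.lowerAtThree_of_children_r17_three`, whose by-name twin `Theorems.Birth.x11aLowerHalfAtThree_of_children_r17_three`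
concludes 23178's route decls and is that item's planner turnkey), so no road is lost, and the split is LOSSLESS (`Theorems.Birth.x11aLowerHalf_iff_lowerAtThree_and_lowerX11aFive`:
L ↔ 23178 ∧ L's `p ≥ 5` restriction); (2) BOOKING — of the four children TWO are existing items by text (23178; 19921) and one is the nine shared
with U3 ∕ U5, so the W-81′ booking of L needs ONE new conjecture item (`stub_mazurMCAtDeepFive`) where r17 needed two conjecture items + three
facts items; (3) named published facts on L's line 14 → 10 (EPW Cor. 5.1.4, Yan–Zhu 4.9, EPW Thm. 1 alg, Kato–Wuthrich A32 move under item 23178,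
which THREE routes consume: ClassRecordThree ∕ KolyvaginRoadThree directly, PrintX11a ∕ ErratumRoadFive through L); (4) ONE research statement
left on the line, `stub_mazurMCAtDeepFive` (Mazur's cyclotomic main conjecture at the deep X11a pairs with `p ≥ 5`, both images; printed only
under (ram), Skinner 2016 Thm. A).  Registered stubs after r18 (4): `stub_mazurMCAtDeepFive` (r17 text) | `stub_x11aLowerHalfAtThree` (NEW; =
item 23178) | `stub_nineFactsOddGS` (9, = U3's) | `stub_gzkFactLower` (NEW cut; = item 19921's body).  W-81′ turnkey: `X11aLowerHalf_holds :=
Theorems.Birth.x11aLowerHalf_of_lowerAtThree_of_children_r18 C_23178 C_nine C_19921 C_MC5`.  CELL READING: L = (item 23178) ∧ (ONE named open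
statement + five printed facts); nothing is asserted about any curve; BSD is not proved by any of this.

RESHAPE r17 (lead gen 7 = prover-bsd-line-x11a-p1-g7-0, 2026-08-28T18:5xZ (announced 18:08:35Z; REF g21 no-objection 18:10:09Z, width seat er5-p2 g11 no-objection 18:25:03Z; helper p656106 ✓, REF V94 PASS 18:26:04Z), «the `p ≥ 5` child in MAZUR currency, uniform with the `p = 3` child;
six chain facts leave the composition»): r16 typed the `p ≥ 5` child as Greenberg's ANALYTIC `μ = 0` on the deep X11a locus (`stub_muAnDeepFive`,
Conj. 1.11) and routed it to the lower half through X. Wan's rational Thm. 4 at an ordinary member of `H(E[p])`, Emerton–Pollack–Weston 3.1.1 ∕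
Thm. 1 alg ∕ 5.1.3, Deligne–Serre 6.1, Hida 3.26 and Kato–Wuthrich A32 (`stub_chainFactsLower`, eight conjuncts), while r15 had already put the
`p = 3` très-ramifié child in MAZUR currency (`X2.MazurMainConjectureAt W 3`) behind the FIVE-fact door
`ClassX11a.missingLowerBoundAt_of_mazurMainConjectureAt_of_facts` (p646859 §1) — a door stated for ANY X11a pair.  r17 applies r15's rationale at
`p ≥ 5`: the `p ≥ 5` child becomes `stub_mazurMCAtDeepFive : ∀ W p, ClassX11a W p → 5 ≤ p → ¬ X11a.ShaAnUnit W p → X2.MazurMainConjectureAt W p`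
(Mazur's cyclotomic main conjecture for `E` itself at EVERY deep X11a pair with `p ≥ 5`, both images of `ρ̄_{E,p}`; OPEN — Skinner 2016 Thm. A
prints it under (irr)+(ram), and X11a has no (ram) prime by definition), routed through the same five-fact door (modularity, Stein–Wuthrich 6.1 ×2,
GZK, Greenberg–Stevens at the pair — NO chain fact), and `stub_chainFactsLower` (8) is re-cut to `stub_katoGZKFactsLower` (TWO conjuncts:
Kato–Wuthrich A32 and GZK, the only chain facts the `p = 3` finite-flat partner road and the door still consume).  The composition `X11aLowerHalf_of`
becomes the lead's `Theorems.Birth.x11aLowerHalf_erratumRoadFive_of_children_r17` (`Theorems/PrintX11aLowerHalfOfChildrenMazurFive.lean`) applied to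
the five stubs BY NAME; the `p = 3` branch is r15∕r16's VERBATIM (`ThreePartner.lowerThreeDeep_of_partnerFF_of_mazurTR_of_facts`).  WHY (numbers):
(1) MONOTONE — r16's `p ≥ 5` text + the shared nine + seven of r16's eight chain facts ⟹ the r17 text
(`Theorems.Birth.mazurMCAtDeepFive_of_muAnDeepFive_of_facts`; kept below as the THEOREM `stub_mazurMCAtDeepFive_of_muAnDeepFive` with the r16 text
as hypothesis), so every proof of the r16 text — and every per-pair `μ`-certificate (ty3: 158 ∕ 158 deep surjective pairs `N < 5·10⁵`) — still
closes the r17 text at its pairs: no road is lost; (2) WEAKEST child — on the SURJECTIVE deep locus at `p ≥ 5` the r17 text is EQUIVALENT to the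
crux restricted there modulo A32, Stein–Wuthrich 6.1 ×2, GZK, modularity, Greenberg–Stevens (`Theorems.Birth.mazurMCAtSurjFive_iff_lowerSurjFive_of_facts`:
the tree's rank-`0` converse `X11a.mazurMainConjectureAt_of_missingLowerBoundAt_heightFree` one way, the door the other), whereas r16's Greenberg-`μ`
text is strictly stronger (`μ^an = 0` is not a consequence of `BSD(E,p)`); (3) DOMINANCE under future print — a (ram)-free multiplicative main
conjecture (the route's own KILL-CRITERIA pivot «BCS §5 programme»; Skinner 2016 Thm. A minus (ram)) closes the r17 child BY INSTANTIATION and would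
NOT close r16's `μ`-child — on the surjective sub-locus this is typed: `stub_mazurMCAtSurjFive_of_baseChangeLowerBound` below feeds the tree's
`X11a.BaseChangeLowerBoundAt` (BCS (5.3) read integrally at `p ‖ N`, OPEN) into the new stub —, while a proof of Greenberg's Conj. 1.11 closes both
(r17 through (1)); (4) ONE currency for both research children;
(5) distinct named published facts on the line 20 → 14 (EPW 3.1.1, EPW Thm. 1 alg at a member, EPW 5.1.3, X. Wan Thm. 4, Deligne–Serre 6.1,
Hida 3.26 leave the composition; they survive only as binders of the monotonicity theorem).  `stub_muAnDeepFive`, `stub_muAnSurjDeepFive` and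
`stub_twinMuAnDeep_of_r16` LEAVE the skeleton (the Greenberg-`μ` texts are not derivable from Mazur's statement; they remain the hypothesis of
`stub_mazurMCAtDeepFive_of_muAnDeepFive`).  Registered stubs after r17 (5): `stub_mazurMCAtDeepFive` (NEW text) | `stub_mazurMCAtTresRamifieThree`
(r15 text, unchanged) | `stub_threePartnerFactsLower` (3) | `stub_nineFactsOddGS` (9, = U3's) | `stub_katoGZKFactsLower` (2; NEW cut of the chain
stub).  W-81′ turnkey: `X11aLowerHalf_holds := Theorems.Birth.x11aLowerHalf_of_children_r17 C_nine C_katoGZK C_facts3 C_MC5 C_MC3`.  CELL READING: 14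
named published facts + TWO named open statements, both «Mazur's cyclotomic main conjecture at the deep X11a pairs» (`p ≥ 5` both images; `p = 3`
très ramifié); nothing is asserted about any curve; BSD is not proved by any of this.

RESHAPE r16 (= er5-p2's «r16-M»; lead gen 6 = prover-bsd-line-x11a-p1-g6-0 with width seat er5-p2 g10, 2026-08-28T17:2xZ, «ONE Greenberg child at
`p ≥ 5` — the line no longer hangs on K2's retired item»; the lead's call after 19948's retirement became final (ledger 17:01:30Z ∕ 17:06:20Z,
closed_as retired) and U5's line of record moved to «gl1cartan5» (cruxlead-20614, 17:12Z), so the r5 image split no longer buys item-sharing): planner bsd-stepL g42's RULING 69 (a)(ii) + phase 1b re-splits K2's crux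
`NonSurjCorner` in SHAPE B and RETIRES its gen-1 children 19946–19949 — among them item 19948 `Theses.ErratumRoadFive.NonSurjCornerTwinMuAn`,
r5–r15's FOURTH child `stub_twinMuAn` BY NAME.  K2's successor child `Theorems.NonSurjCornerTwinMuAnDeep` (p645655) asks the analytic `μ = 0` ONLY at
the Friedberg–Hoffstein twin models of DEEP X11b corner pairs: it is TWIST-RESTRICTED and does NOT imply 19948's class-wide X11a text nor its
restriction to deep X11a pairs (the implication goes the other way, K2's `twinMuAnDeep_of_twinMuAn`), so it cannot carry L's fourth child.  What
r15's composition CONSUMED of 19948 is only its merger with the fifth child into the both-images certificate «`X11a.MuAnZeroAt W p` at every DEEP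
X11a pair with `p ≥ 5`» (`muAnDeepFive_of_nonSurjCornerTwinMuAn_of_surjDeep`, modulo Balakrishnan et al. Thm. 1.2) — VERBATIM the line's r3∕r4
registered text `stub_muAnDeepFive`.  So r16-M registers THAT text again as the ONE `p ≥ 5` child — `stub_muAnDeepFive : ∀ W p, ClassX11a W p →
5 ≤ p → ¬ X11a.ShaAnUnit W p → X11a.MuAnZeroAt W p` (Greenberg's Conj. 1.11, analytic form, on the WHOLE deep X11a locus at `p ≥ 5`, both images;
OPEN class-wide; per pair a finite modular-symbol certificate: 158 ∕ 158 deep surjective pairs with `N < 5·10⁵` certified, no deep non-surjective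
pair known in that range) —, `stub_muAnSurjDeepFive` becomes a THEOREM (its restriction to the surjective image), `stub_twinMuAn` LEAVES the
skeleton (19948's full text, unit pairs included, is not derivable from the deep certificate; its DEEP restriction is: er5-p2 g10's
`Birth.nonSurjTwinMuAnDeep_of_muAnDeepFive`, pure logic), Balakrishnan–Dogra–Müller–Tuitman–Vonk Thm. 1.2 LEAVES the line (it only routed
`¬Surj ⟹ p ∈ {5,7}` into 19948: `stub_chainFactsLower` 9 → 8 conjuncts, same order), and the composition `X11aLowerHalf_of` becomes er5-p2 g10's
five-children theorem `Theorems.Birth.x11aLowerHalf_erratumRoadFive_of_children_r16` (`Theorems/PrintX11aLowerHalfOfChildrenMuFive.lean`)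
applied to the five stubs BY NAME.  MONOTONE: r15's fourth + fifth texts ⟹ the r16-M text modulo BDMTV (tree adapter above), r15's nine chain
facts ⟹ the eight (`Birth.chainEight_of_chainNine`); conversely the r16-M text ⟹ r15's fifth and the deep restriction of its fourth — so no road is
lost and nothing provable is added.  ALTERNATIVES the lead may prefer (same helper file): r16-K = keep six stubs with the fourth re-cut to 19948's
text restricted to deep pairs (`…_of_children_r16K`, nine chain facts); r15 unchanged with 19948's statement re-homed by the planners as an input
item of route `PrintX11a`.  Registered stubs after r16-M (5): `stub_muAnDeepFive` | `stub_mazurMCAtTresRamifieThree` | `stub_threePartnerFactsLower`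
(3) | `stub_nineFactsOddGS` (9, = U3's) | `stub_chainFactsLower` (8).  Distinct named published facts on the line: 20.  W-81′ turnkey:
`X11aLowerHalf_holds := Theorems.Birth.x11aLowerHalf_of_children_r16 C_nine C_chain8 C_facts3 C_mu5 C_MC3`.  CELL READING: 20 named facts + TWO
named open statements (Greenberg Conj. 1.11 on the deep X11a pairs at `p ≥ 5`; Mazur's cyclotomic main conjecture at `3` on the très-ramifié deep
X11a pairs); nothing is asserted about any curve; BSD is not proved by any of this.

Skeleton of record (D-0154 KEY 2026-08-28T03:03:38Z row 11: «19064 c998db5e»): the BC3 birth skeleton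
registered by planner bsd-stepL-plan g24 (2026-08-26T09:15:57Z, sha16 c998db5e9f13a878; stubs `stub_lowerSurj` |
`stub_lowerNonSurj`), re-typed BY NAME and held by the line's lead seat bsd-line-x11a-p1 (this file =
`Cruxes/X11aLowerHalf/Lines/birth.lean` = the lead's `work/X11aLowerHalf.lean`), RESHAPED ONCE by the lead
(2026-08-28, r1 «off-unit»): the SAME two-way cut by the image of `ρ̄_{E,p}`, each stub now typed OFF the unit
pairs — the honest form the cell referee asked for (REF g12 `LinePolice19064` P2 / S0′, REF g13): on a unit pair
(`#Ш(E)_an` a rational `p`-adic unit, `X11a.ShaAnUnit`) the lower half holds outright, fact-free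
(`missingLowerBoundAt_of_shaAnUnit` below), so each birth stub is EQUIVALENT to its off-unit restriction
(`stub_lowerSurj_iff_deep`, `stub_lowerNonSurj_iff_deep` below, pure logic) and nothing provable was added or
removed; what changed is that every registered stub now names exactly the pairs that carry content (the deep
pairs `p ∣ #Ш_an`). Nothing is asserted about any curve; BSD is not proved by any of this; the two `sorry`s below
are exactly the two registered stubs; the composition `X11aLowerHalf_of` is a real (fact-free) proof that
concludes the crux decl `Summit.BirchSwinnertonDyer.BirchSwinnertonDyer.Theses.ErratumRoadFive.X11aLowerHalf`
BY NAME (and `X11aLowerHalf_of_printX11a` the `PrintX11a` spelling, the same statement by `Iff.rfl`).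

RESHAPE r15 (lead gen 6 = prover-bsd-line-x11a-p1-g6-0 with width seat er5-p2 g8, 2026-08-28T16:1xZ, «the très-ramifié residual in
MAZUR-MAIN-CONJECTURE currency»): r12–r14 displayed the open core of the `p = 3` très-ramifié deep X11a locus (`3 ∤ ord₃ Δ_min`; 359 ∕ 448 deep
classes in range) in MEMBER currency — `stub_memberRatEqAtTresRamifieThree`: «some `3`-ordinary member `g ∈ S_k(Γ₀(M))`, `3 ∤ M`, of `H(E[3])`
satisfies the RATIONAL cyclotomic identity» (X. Wan's Thm. 4 shape at `3`).  Width seat er5-p2 g8's file `Theorems/PrintX11aLowerHalfThreeMazurCore.lean`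
(p646859 ✓, 2026-08-28T16:05:55Z) shows that EVERY road of the line at `p = 3` passes through ONE hinge predicate already in the tree, `X2.MazurMainConjectureAt W p`
(`Rank1Residual/X2/Cells.lean`: Mazur's cyclotomic main conjecture for `E` ITSELF at the multiplicative prime, Néron-normalised, trivial zero
included — verbatim the conclusion of Skinner 2016 Thm. A, printed under (irr) + (ram)): (i) the door
`ClassX11a.missingLowerBoundAt_of_mazurMainConjectureAt_of_facts` gives the lower half at ANY X11a pair from Mazur's statement at the pair and FIVE
of the shared nine (Stein–Wuthrich 6.1 ×2, GZK, modularity, Greenberg–Stevens) — NO chain fact; (ii) MONOTONICITY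
`Birth.mazurTR_of_memberTR_of_chainFacts`: the registered r14 member text + facts ALREADY on the line (EPW 3.1.1 ∕ Thm 1 alg ∕ 5.1.3, Deligne–Serre,
Hida 3.26, Kato–Wuthrich A32, GS, Mazur 4.1, modularity; Wuthrich's Lemma 20 from the tree) IMPLIES Mazur's statement on the locus.  So r15
RE-CUTS the sixth stub from member currency to Mazur currency — `stub_mazurMCAtTresRamifieThree : ∀ W p, ClassX11a W p → p = 3 →
¬ X11a.ShaAnUnit W p → ¬ p ∣ padicValInt p W.minimalDiscriminantInt → X2.MazurMainConjectureAt W p` (the binder `hMC3` of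
`Theorems.Birth.x11aLowerHalf_of_children_r15` VERBATIM) — and the composition `X11aLowerHalf_of` becomes er5-p2 g8's
`Theorems.Birth.x11aLowerHalf_erratumRoadFive_of_children_r15` applied to the six stubs BY NAME.  WHY (the lead's call, REF g21 no-objection
2026-08-28T15:27:56Z): (a) the re-cut is MONOTONE — every proof of the r14 text closes the r15 text modulo facts on the line
(`stub_mazurMCAtTresRamifieThree_of_memberTR` below, a THEOREM with the r14 text as hypothesis), so no road is lost, and the r15 text is
WEAKER-OR-EQUAL as a research ask (it is ALSO implied by any future (ram)-free multiplicative analogue at `3` of Skinner 2016 Thm. A ∕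
Burungale–Castella–Skinner, which the member text is not); (b) it is the CANONICAL statement — Mazur's cyclotomic main conjecture at `p = 3` for a
rank-`0` curve with `3 ‖ N`, `E[3]` irreducible (hence onto, `ClassX11a.surj_of_not_dvd`), `3 ∤ ord₃ Δ_min`, no (ram) prime — of which the member
statement, X. Wan's Thm. 4 at `3` and Skinner–Urban 3.6.4 at `3` (flagged) are SUFFICIENT conditions; on this locus Kato–Wuthrich A32 + Lemma 20
already give the integral divisibility `char ∣ L_3`, so the open content is ONE divisibility; (c) the très-ramifié branch now consumes 5 shared
facts instead of 13 (the nine chain facts serve `p ≥ 5` only).  Registered stubs after r15 (6): `stub_twinMuAn` (= 19948) | `stub_muAnSurjDeepFive` |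
`stub_mazurMCAtTresRamifieThree` (NEW text) | `stub_threePartnerFactsLower` (3) | `stub_nineFactsOddGS` (9, = U3's) | `stub_chainFactsLower` (9).
Distinct named published facts on the line: 21 (unchanged, flag-free).  r7's `stub_lowerTresRamifieThree` stays a THEOREM (now := §1's door fed by
the Mazur stub).  Nothing provable added or removed beyond the monotone re-cut; NOT in print at `3`; nothing is asserted about any curve; CELL
READING: 21 named facts + item 19948 + TWO named open statements (Greenberg Conj. 1.11 ω⁰ on the deep surjective X11a pairs at `p ≥ 5`; Mazur's
cyclotomic main conjecture at `3` on the très-ramifié deep X11a pairs); BSD is not proved by any of this.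

RESHAPE r14 (lead gen 4 with width seat er5-p2 g7, 2026-08-28T14:4xZ, «DROP THE KODAIRA ROAD — a flag-free line»): r3–r13 routed the deep
X11a pairs at `p = 3` three ways — Kodaira sub-locus (Surj ∧ an additive IV/IV* place; 91 ∕ 448 classes in range = 18 finite-flat + 73 très-ramifié)
through g3's (ram) member and Skinner–Urban 3.6.4-ram (INPUTS G54, the line's ONLY counting-flagged input `SU14-12.3.6-mu@nonsplit@3`: «no closure
counted through it») after Ribet–DDT's additive drop (G52) and Carayol–Livné (G53); finite-flat off-Kodaira through the partner road; très-ramifié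
off-Kodaira through the member stub.  But neither surviving road needs the Kodaira condition: the good-ordinary 3-congruent partner exists on the
WHOLE finite-flat locus (`UniversalToricDescentPeuRamifieResupply.exists_goodOrd_twin_of_mult_of_three_dvd_padicValInt`, no Kodaira hypothesis;
`stub_partnerThree` ignores that binder) and the per-pair member door `ClassX11a.missingLowerBoundAt_three_of_tresRamifie_of_memberRatEqAt_of_facts`
takes none.  So r14 routes TWO ways — finite flat (all 89 classes) → the THREE-fact partner road; très ramifié (all 359 classes) → the member
research stub WIDENED to the whole très-ramifié deep locus (`stub_memberRatEqAtTresRamifieThree` loses its `¬(Surj ∧ Kodaira)` binder; same open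
problem, X. Wan's Thm. 4 at `p = 3`) — and G52, G53, G54 LEAVE the line: `stub_suRamFactLower` is RETIRED, `stub_elevenFactsLower` becomes
`stub_chainFactsLower` (the nine member-chain facts: EPW 3.1.1 ∕ Thm. 1 alg ∕ 5.1.3, X. Wan Thm. 4 (p ≥ 5), Deligne–Serre 6.1, Hida 3.26,
Kato–Wuthrich A32, GZK, BDMTV — the eleven minus G52 ∕ G53, same order).  Effect: registered stubs 7 → 6, distinct named published facts 24 → 21,
and the counting flag SU14-12.3.6@3 is GONE from line L (disclosure tokens EPW06@3 ∕ YZ26@3 remain on the partner facts); cost, stated: the 73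
Kodaira∩très-ramifié classes move from «closure modulo a flagged print (counted as none)» into the open member statement; g3's Kodaira doors
(p621194 ∕ p623401) stay in the tree for the day Skinner–Urban at 3 is repaired.  r8–r13's reassembled bundles `stub_twentyFactsLower` ∕
`stub_printFactsLower` and the derivation `stub_lowerThreeDeep_of_r7` are RETIRED with the facts they consumed (history below); the composition
`X11aLowerHalf_of` is now er5-p2 g7's six-children theorem `Theorems.Birth.x11aLowerHalf_of_children_r14` (`Theorems/PrintX11aLowerHalfThreeNoKodaira.lean`, p641600 ✓) applied to the six stubs BY NAME (finite-flat
first, then très ramifié; `p ≥ 5` as before through 19948 + the surjective certificate + Wan's member), so the W-81′ booking glue IS the composition.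
Registered stubs after r14 (6): `stub_twinMuAn` (= 19948) | `stub_muAnSurjDeepFive` | `stub_memberRatEqAtTresRamifieThree` (widened) |
`stub_threePartnerFactsLower` (3) | `stub_nineFactsOddGS` (9, = U3's) | `stub_chainFactsLower` (9).  CELL READING: 21 named published facts
(flag-free) + item 19948 + TWO named open statements (Greenberg Conj. 1.11 ω⁰ on the deep surjective X11a pairs at p ≥ 5; the rational cyclotomic
main conjecture at 3 for an ordinary member of H(E[3]) on the très-ramifié deep X11a pairs); BSD is not proved by any of this.

RESHAPE r13 (lead gen 4, 2026-08-28T14:3xZ, «EPW Thm. 1 (∗ = an) LEAVES the line: THEOREM B» — width seat er5-p2 g7's finding): the fourth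
partner fact `EmertonPollackWeston2006.thm1_muAn_transfer_goodOrdinary_of_mult_odd` (INPUTS G43: the analytic `μ = 0` transported from the
multiplicative curve to its good-ordinary `3`-congruent partner `A`) was consumed once, to get a `3`-adic unit coefficient of `ϖ·L_3(f_A, α_A)`; but
Greenberg's analytic `μ₃ = 0` at EVERY globally minimal curve good ordinary at `3` with irreducible `3`-torsion is a THEOREM of the tree, fact-free —
cell bsd-f3-mu's line «theoremB-x10b» closed crux 20682 `PrintX10b.AnalyticMuZeroX10b` (Vaserstein over `ℤ[1/m]` ⟹ THEOREM B ⟹ non-constancy ⟹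
unit Mazur–Swinnerton-Dyer measure value ⟹ unit coefficient) — and er5-p2's `Theorems/PrintX11aLowerHalfThreePartnerTheoremB.lean` (p639703 ✓)
re-proves the whole partner chain at `3` WITHOUT G43 (and without F6): `ThreePartner.x11aLowerHalf_of_printFactsLower_of_threePartnerFacts_of_muAnFive_of_partner_of_tresRamifie`.
So r13 registers `stub_threePartnerFactsLower` (EPW Cor. 5.1.4 · Yan–Zhu Thm. 4.9 · EPW Thm. 1 alg = that theorem's binder `hQ3` VERBATIM), drops
r11's `stub_fourPartnerFactsLower` and the five-conjunct theorem `stub_partnerFactsLower` (G43 itself is not a theorem — only its use is bypassed —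
so the old bundles are no longer derivable and no consumer of them remains), and switches the composition `X11aLowerHalf_of` to er5-p2's new
class-level theorem (same five inputs otherwise: `stub_printFactsLower`, `stub_muAnDeepFive_of_r5`, `stub_partnerThree`, `stub_lowerTresRamifieThree` —
the latter a theorem since r12 from the MEMBER stub); `stub_lowerThreeDeep_of_r7` is re-derived through `…_of_contraFacts_of_theoremB`.
Registered stubs after r13 (7 = stubs_max): `stub_twinMuAn` (= 19948) | `stub_muAnSurjDeepFive` | `stub_memberRatEqAtTresRamifieThree` |
`stub_threePartnerFactsLower` (3) | `stub_nineFactsOddGS` (9, = U3's) | `stub_elevenFactsLower` (11) | `stub_suRamFactLower` (1, flagged) —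
24 distinct named published facts on the line (r10: 26).  Children glue for the W-81′ booking: `Theorems.Birth.x11aLowerHalf_of_children_r13`
(seven r13 texts; er5-p2 g7 or the lead).  CELL READING: 24 named facts + item 19948 + TWO named open statements; BSD is not proved by any of this.

RESHAPE r12 (lead gen 4, 2026-08-28T14:2xZ, «the très-ramifié open core NAMED: the rational cyclotomic main-conjecture equality at 3 for ONE
good-ordinary member of H(E[3])»): width seat er5-p2's landed door `Theorems/PrintX11aLowerHalfTresRamifieCore.lean` (g6, p634533 + p635700;
REF V73 ∕ V74 PASS-AS-DOOR) proves, AT A PAIR of the très-ramifié off-Kodaira deep X11a locus at `3`,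
`ClassX11a.missingLowerBoundAt_three_of_tresRamifie_of_memberRatEqAt_of_facts`: the lower half ⟸ twelve of the line's named facts (all among the
shared nine and the eleven; Wuthrich Lemma 20 from the tree) + Greenberg–Stevens AT THE PAIR (so the ODD-keyed display of the nine suffices:
`3 ≠ 2`) + `OddChain.MemberRatEqAt W 3` («some `3`-ordinary member `g ∈ S_k(Γ₀(M))`, `3 ∤ M`, of `H(E[3])` satisfies X. Wan's Thm. 4 conclusion —
`char_Λ X(ℚ_∞, A_g) = (L_3(g))` in `Λ_𝒪 ⊗ ℚ_3`»; Wan 2015 prints `p ⩾ 5`; at `3` NOT in print — er5-p2's census `TR-CORE-DOORS-g6.md`, barrier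
candidate «B-3±1: every auxiliary prime `q ≠ 3` has `q² ≡ 1 (mod 3)`»).  So r12 registers the research statement in THAT currency —
`stub_memberRatEqAtTresRamifieThree` = the binder `hmem` of `OddChain.tresRamifieThree_of_forall_memberRatEqAt_of_twelveFacts` VERBATIM (REF text
pin V73) — and r7's `stub_lowerTresRamifieThree` (the lower half on the locus) becomes a THEOREM := that door fed by the nine, the eleven, the
tree's Lemma 20 and the new stub; the composition is byte-identical.  WHY: both OPEN statements of line L are now NAMED Iwasawa-theoretic
conjecture instances — Greenberg Conj. 1.11 (analytic ω⁰ branch) on the deep surjective X11a pairs at `p ≥ 5` (`stub_muAnSurjDeepFive`) and the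
Skinner–Urban ∕ X. Wan rational main-conjecture equality at `p = 3` for an ordinary member of `H(E[3])`, `E` multiplicative and très ramifié at 3,
`E[3]` irreducible, no (ram) prime (`stub_memberRatEqAtTresRamifieThree`) — instead of one named conjecture and one BSD-internal locus statement; the
new stub is (per pair) STRONGER than the old one only through the landed chain, i.e. it is exactly the input every printed lower-bound road at a
multiplicative prime consumes.  Registered stubs after r12 (7 = stubs_max): `stub_twinMuAn` (= 19948) | `stub_muAnSurjDeepFive` |
`stub_memberRatEqAtTresRamifieThree` | `stub_fourPartnerFactsLower` (4) | `stub_nineFactsOddGS` (9, = U3's) | `stub_elevenFactsLower` (11) |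
`stub_suRamFactLower` (1, flagged).  Children glue for the W-81′ booking: `Theorems.Birth.x11aLowerHalf_of_children_r12` (lead g4, new file
`Theorems/PrintX11aLowerHalfOfChildrenMemberThree.lean` = er5-p2 g7's `…_of_children_r11` (p638322) with C₇ fed through the door).  Nothing provable
added or removed beyond the fold; CELL READING: 25 named published facts + item 19948 + TWO named open statements; BSD is not proved by any of this.

RESHAPE r11 (lead gen 4 = prover-bsd-line-x11a-p1-g4-0, 2026-08-28T14:0xZ, «the period unit at 3 FOLDED into Mazur Cor. 4.1»): conjunct 3
of r10's `stub_partnerFactsLower` — `SkinnerUrban2014.realPeriodRat_eq_unit_mul_plusPeriod_three` (the `3`-adic unit `Ω_E ∕ Ω_E⁺` at a GOOD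
prime `3`, `E[3]` irreducible; INPUTS-LIST-2 F6) — is a THEOREM of the tree GIVEN Mazur 1978 Cor. 4.1 (`mazur_not_dvd_maninConstant_of_odd`, F7 =
conjunct 9 of the shared nine `stub_nineFactsOddGS`): `SkinnerUrban2014.realPeriodRat_eq_unit_mul_plusPeriod_three_of_mazur`
(`PAdicUnitPeriodRatioProofs.lean`), packaged for this line by the INPUTS desk's T21 = `Theorems.PrintX11a.InputsPartnerFacts.partnerFactsLower_of_four_of_mazur`
(`Theorems/PrintX11aLowerHalfPartnerFactsOfFourOfMazur.lean`, p637825 ✓).  So r11 registers the FOUR printed partner facts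
(`stub_fourPartnerFactsLower`: EPW Cor. 5.1.4 · Yan–Zhu Thm. 4.9 · EPW Thm. 1 alg · EPW Thm. 1 an — T21's hypothesis text VERBATIM) and
r10's five-conjunct `stub_partnerFactsLower` becomes a THEOREM := T21 (four stub) (conjunct 9 of the nine stub); every consumer below and the
composition are byte-identical.  Registered stubs after r11 (7 = stubs_max): `stub_twinMuAn` (= 19948) | `stub_muAnSurjDeepFive` |
`stub_lowerTresRamifieThree` | `stub_fourPartnerFactsLower` (4) | `stub_nineFactsOddGS` (9, = U3's) | `stub_elevenFactsLower` (11) |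
`stub_suRamFactLower` (1, flagged) — 25 distinct named published facts on the line (was 26).  Children glue for the W-81′ booking:
`Theorems.Birth.x11aLowerHalf_of_children_r11` (width seat er5-p2 g7, `Theorems/PrintX11aLowerHalfOfChildrenFourPartner.lean`; until it lands,
r10's `…_of_children_r10` fed `partnerFactsLower_of_four_of_mazur C₄ C₁.2.2.2.2.2.2.2.2` is the same booking).  Nothing provable added or removed
beyond the fold; CELL READING unchanged (two OPEN statements + named facts + 19948); BSD is not proved by any of this.

RESHAPE r10 (lead gen 3, 2026-08-28T13:2xZ, «ONE nine-fact input item for U3, U5 and L»): the nine print-exact facts of crux U3's only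
registered stub `FineMu.stub_nineFactsOddGS` (finemu3 r6, item 20613; shared VERBATIM by U5's finemu5 r7, item 20614) are nine of r9's
twenty (`stub_twentyFactsLower`), so r10 states them as the stub `stub_nineFactsOddGS` WITH U3's TEXT VERBATIM and the other eleven as
`stub_elevenFactsLower`; `stub_twentyFactsLower` becomes a THEOREM (pure reassembly), hence so do `stub_printFactsLower` and everything
below, byte-identical.  Purpose: the planner's W-81′ booking can file ONE nine-fact statement item that the landed glues of ALL THREE cruxes
consume by name (U3: `Theorems.upperNonSurjThree_of_nineFacts_oddGS_glue`; U5: `…upperNonSurjFive_of_nonSurjCornerTwinMuAn_of_nineFactsOddGS_glue₃`;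
L: `Theorems.Birth.x11aLowerHalf_of_children_r10`, new file `Theorems/PrintX11aLowerHalfOfChildrenSharedNine.lean` — the r7∕r8∕r9 glue file
is at the 400-line cap) — twenty distinct facts in twenty slots instead of twenty-nine.  Registered stubs after r10 (7 = stubs_max): `stub_twinMuAn` (= 19948) | `stub_muAnSurjDeepFive` |
`stub_lowerTresRamifieThree` | `stub_partnerFactsLower` (5) | `stub_nineFactsOddGS` (9, = U3's) | `stub_elevenFactsLower` (11) |
`stub_suRamFactLower` (1, flagged).  Nothing provable added or removed; CELL READING unchanged; BSD is not proved by any of this.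

RESHAPE r9 (lead gen 3 = prover-bsd-line-x11a-p1-g3-0, 2026-08-28T12:5xZ, «one print fact DISCHARGED by the tree, the flagged
one ISOLATED» — cell referee REF g18 line police R.26 remark C1 and width seat -w2 g5's scan): of the twenty-two print-exact named
facts of r8's `stub_printFactsLower`, EXACTLY ONE is a THEOREM of the tree — Wuthrich 2014 Lemma 20 («`p = 3`, `9 ∤ N`, `ρ̄` onto ⟹ `ρ`
onto `GL₂(ℤ₃)`»), proved locally at `3` in `Literature/…/Wuthrich2014/ThreeAdicImageSupersingularProofs.lean`
(`Wuthrich2014.lemma20_surjective_threeAdic_of_semistable_holds`, axioms trio; scan of the other 26 + U3's nine for a tree proof under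
any name: 0 hits) — so conjunct 9 is FED BY THE TREE and leaves the registered set; and conjunct 21 — Skinner–Urban Thm. 3.6.4 RATIONAL at a
weight-`k` member WITH (ram), the only conjunct carrying a COUNTING flag (`SU14-12.3.6-mu@nonsplit@3`, consumed only on the Kodaira
sub-locus at `p = 3`) — becomes its OWN registered fact stub `stub_suRamFactLower`, so that the remaining TWENTY print-exact facts
(`stub_twentyFactsLower`) form a flag-free countable bundle («split it out of the facts item for countability», REF R.26 C1).
`stub_printFactsLower` (the 22-conjunct r8 text) is now a THEOREM := ⟨twenty stubs, Lemma 20 from the tree, the (ram) stub⟩, so every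
r8 consumer below and the composition are byte-identical.  Registered stubs after r9 (6 ≤ stubs_max): `stub_twinMuAn` (= 19948) |
`stub_muAnSurjDeepFive` | `stub_lowerTresRamifieThree` | `stub_partnerFactsLower` (5) | `stub_twentyFactsLower` (20) |
`stub_suRamFactLower` (1, flagged).  Children glue for the W-81′ booking: `Theorems.Birth.x11aLowerHalf_of_children_r9` (APPEND to
`Theorems/PrintX11aLowerHalfOfChildren.lean`).  CELL READING unchanged: modulo 26 named published facts (one of them print-gap-flagged at
`3`) and K2's item 19948, crux L = [Greenberg μ^an(ω⁰) = 0 on the deep SURJECTIVE X11a pairs at `p ≥ 5` — OPEN] + [the lower half on the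
très-ramifié off-Kodaira deep X11a pairs at `3` — OPEN CORE].  BSD is not proved by any of this.

RESHAPE r8 (lead gen 2 = prover-bsd-line-x11a-p1-g2-0, 2026-08-28T12:1xZ, «stub_partnerThree DISCHARGED»): the r7 stub
`stub_partnerThree` is PROVED, fact-free and class-wide, by the lead's `Theorems/PrintX11aLowerHalfPartnerThree.lean` (p632020 ✓,
`--supports 19064`, registered stub by name + signature): the tree already held — route `UniversalToricDescent`, width seat
bsd-wall-utd-p2-w2 g3 — `UniversalToricDescentPeuRamifieResupply.exists_goodOrd_twin_of_mult_of_three_dvd_padicValInt` (every globally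
minimal curve multiplicative at 3 with `3 ∣ v₃(Δ_min)` has a globally minimal 3-congruent twin GOOD ORDINARY at 3: the Hesse-pencil
member at `(−c₆ + 3^{v₃(Δ)/3}c₄ : c₄)`, Fisher 2012 Thm 13.2 PROVED in the tree, `a₃ ≡ b₂ = 4ρ ≢ 0 (mod 3)`; axioms trio), whose
conclusion unfolds to the stub's with the isomorphism reversed.  So `stub_partnerThree` below is now a THEOREM (no `sorry`), the
registered stubs after r8 are FIVE: `stub_twinMuAn` (= 19948) | `stub_muAnSurjDeepFive` | `stub_lowerTresRamifieThree` |
`stub_printFactsLower` (22) | `stub_partnerFactsLower` (5), and the p = 3 residual of crux L is EXACTLY the très-ramifié open core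
(286 ∕ 448 deep classes in range) plus named facts.  Composition unchanged.  BSD is not proved by any of this.

RESHAPE r7 (ADOPTED by the lead gen 2 = prover-bsd-line-x11a-p1-g2-0, 2026-08-28T11:4xZ, from the TURNKEY text of width seat
er5-p2 g4 (p629328 ✓); «the p = 3 off-Kodaira locus cut by finite flatness», in r6's print-exact currency).  Lead's check of the new
`∀`-stub before registering it: `stub_partnerThree` is TRUE class-wide by a known argument outside the tree — `X_E(3) ≅ ℙ¹_ℚ`
(genus 0 with the rational point `[E, id]`; Rubin–Silverberg's explicit mod-3 family), every local type at 3 of a multiplicative `E` with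
`E[3]|_{G_{ℚ₃}}` finite flat (extension of `ℤ/3 ⊗ δ` by `μ₃ ⊗ δ`, `δ` unramified quadratic, peu-ramifié class in `ℤ₃ˣ/(ℤ₃ˣ)³ ≅ ℤ/3`, either
symplectic type) is realised by a good ORDINARY curve over `ℚ₃` (Serre–Tate lifts of an ordinary `Ā/𝔽₃` with `a₃(Ā) ≡ δ(Frob₃)`), `ℙ¹(ℚ)` is
dense in `ℙ¹(ℚ₃)`, and good-ordinary reduction at 3 with its `a₃` is 3-adically locally constant on `Y_E(3)(ℚ₃)`; on the très-ramifié locus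
the same argument shows NO good partner exists — so the cut is exactly along provability.  er5-p2 g4 landed the WEIGHT-TWO PARTNER road at p = 3 (p626377 Literature: EPW 2006 Cor. 5.1.4
good ⟶ mult and Thm. 1 alg ∕ an mult ⟶ good at an ODD prime [flag EPW06@3-Hida-control]; p627615 `Theorems/PrintX11aLowerHalfThreePartner.lean`;
p628833 `…ThreePartnerByName.lean`; `…ThreePartnerContra.lean` = the same in r6's currency + the glue
`ThreePartner.x11aLowerHalf_of_printFactsLower_of_partnerFacts_of_muAnFive_of_partner_of_tresRamifie`): at a deep X11a pair with p = 3 OFF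
the Kodaira sub-locus whose `E[3]|_{G_{ℚ₃}}` is FINITE FLAT (`3 ∣ ord₃ Δ_min`) the lower half follows from named facts GIVEN a good-ordinary
3-congruent partner `A` (Yan–Zhu 2026 Thm. 4.9 RATIONAL main conjecture at `A` [flag YZ26@3-BF-ERL-Ohta]; `μ^alg`, `μ^an` moved from `E` —
`μ^an(E,3) = 0` being x11a-p2's theorem and `μ^alg(E) = 0` Kato's side — to `A` by EPW Thm. 1; Greenberg–Vatsal 3.7 integrality; EPW
Cor. 5.1.4 back to `E`; height-free socket).  `stub_memberRatEqAtThree_offKodaira` is therefore CUT into `stub_partnerThree` (on the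
FINITE-FLAT off-Kodaira deep locus at 3 EVERY pair has such a partner — per pair a finite certificate [a curve + a Kraus–Oesterlé congruence
list; census N < 5·10⁵: 67 ∕ 71 classes carry one of conductor < 5·10⁵, each re-verified congruent mod 3 at every good prime < 1000, 52 at
level exactly N ∕ 3; data seat bsd-print-x11a-ty3 g6 is producing the two-engine lists]; class-wide = Rubin–Silverberg's mod-3 family + a
3-adic Serre–Tate argument, NOT in the tree) and `stub_lowerTresRamifieThree` (the lower half on the TRÈS-RAMIFIÉ off-Kodaira deep locus at
3 — 286 ∕ 448 classes, all `ρ̄` onto — THE OPEN CORE: no partner exists, no member of `H(E[3])` has a (ram) prime, no weight-`k > 2` source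
prints p = 3), plus the five-fact bundle `stub_partnerFactsLower`.  r4's `stub_memberRatEqAtThree` is no longer derived (the partner road
yields the lower half, not Wan's equality at a weight-`k` member); r3's `stub_lowerThreeDeep` IS (`stub_lowerThreeDeep_of_r7`).  Composition
= er5-p2 g4's glue fed `stub_printFactsLower`, `stub_partnerFactsLower`, `stub_muAnDeepFive_of_r5`, `stub_partnerThree`,
`stub_lowerTresRamifieThree`.  Registered stubs after r7 (6 ≤ stubs_max): `stub_twinMuAn` (= 19948) | `stub_muAnSurjDeepFive` |
`stub_partnerThree` | `stub_lowerTresRamifieThree` | `stub_printFactsLower` (22) | `stub_partnerFactsLower` (5).  CELL READING after r7,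
modulo named published facts and K2's item 19948: crux L = [Greenberg μ^an on the deep SURJECTIVE X11a pairs at p ≥ 5] + [a good-ordinary
3-congruent partner at every finite-flat off-Kodaira deep pair at 3 (71 ∕ 448; per pair certifiable)] + [the lower half on the très-ramifié
off-Kodaira deep pairs at 3 (286 ∕ 448; the open core)].  BSD is not proved by any of this.

RESHAPE r6 (lead gen 1, 2026-08-28T11:1xZ, «print-exact inputs; 19949 retired»): the lead's `Theorems/PrintX11aLowerHalfBodyOfContraFacts.lean`
(W-L1, REF g18 caveat C2) re-keys the composition on EIGHTEEN print-exact named facts — Kato §17.13 in the contragredient form V′ ∕ VI′ ∕ XI′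
(`…_contra`, x11a-p2 g3's `X11b.multDivisibilityAt_of_katoFacts_of_muAnZeroAt_contra_of_mazur`), Greenberg–Stevens at ODD primes only, Wuthrich
Cor. 18 ∕ Greenberg 1.5 ∕ Kato's `nonempty_iwasawaH1Data` DISCHARGED (theorems of the tree) — so the registered fact stubs become ONE:
`stub_printFactsLower` = those eighteen ∧ BDMTV ∧ Ribet–DDT additive drop ∧ Skinner–Urban 3.6.4 (ram) [flag SU14-12.3.6 @3] ∧ Carayol–Livné (TWENTY-TWO
statement-only named facts, none γ-keyed; `stub_pubFactsLower` = item 19949 — all-prime GS conjunct 14, γ-keyed conjuncts 19/20/23 — is RETIRED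
from the registered set).  Registered stubs after r6: `stub_twinMuAn` (= 19948) | `stub_muAnSurjDeepFive` | `stub_memberRatEqAtThree_offKodaira` |
`stub_printFactsLower`.  Composition `X11aLowerHalf_of` = `OddChain.x11aLowerHalf_of_printFactsLower_of_muAnFive_of_memberRatEqAtThree` fed the
derived r4 inputs.  CELL READING unchanged: crux L = 19948 + [μ^an on the deep SURJECTIVE X11a pairs, p ≥ 5] + [member equality off the Kodaira
sub-locus, p = 3] + twenty-two print facts.  BSD is not proved by any of this.

RESHAPE r5 (lead gen 1 = prover-bsd-line-x11a-p1-g0-0, 2026-08-28T10:5xZ, «name what is already an item; isolate the cell's own residual»):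
(i) p ≥ 5, NON-surjective image: the lead's `Theorems/PrintX11aNonSurjMuAnHardFiveIffTwinMuAn.lean` proves that U5's registered stub
`Theorems.X11aNonSurjMuAnHardFive` and K2's item 19948 `Theorems.NonSurjCornerTwinMuAn` are EQUIVALENT (fact-free one way, modulo
Balakrishnan–Dogra–Müller–Tuitman–Vonk Thm. 1.2 the other; off the hard sub-locus the certificate is free, fact-free), and that either gives
`X11a.MuAnZeroAt` at every non-surjective X11a pair with `p ≥ 5`; so the non-surjective side of r4's `stub_muAnDeepFive` is RE-KEYED to the
EXISTING item 19948 BY NAME (`stub_twinMuAn`, as in r2) and BDMTV joins the chain-fact bundle.  (ii) p ≥ 5, SURJECTIVE image: the new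
registered stub `stub_muAnSurjDeepFive` — Greenberg's analytic μ = 0 at the deep SURJECTIVE X11a pairs, `p ≥ 5` — is the cell's OWN residual
(barrier B3 «no-ram»: SU 3.6.4 ∕ Skinner 2016 Thm C without the auxiliary ramified prime; 158/158 deep surjective pairs with N < 5·10⁵ certified
PER PAIR by the cell's engines; class-wide OPEN = LNM 1716 Conj. 1.11 on this locus); r4's `stub_muAnDeepFive` is DERIVED
(`stub_muAnDeepFive_of_r5`).  (iii) p = 3: width seat er5-p2 g3 CONSTRUCTED the «ram member» on the Kodaira sub-locus (p621194) and discharged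
its level lower bound by the Carayol–Livné fact (p620825, p623401): `stub_memberRatEqAtThree` is CUT to the complement
`stub_memberRatEqAtThree_offKodaira` (er5-p2 g3's turnkey `OddChain.memberRatEqAtThree_of_offKodaira_of_facts`, KODAIRA-MEMBER.md §5) and the
three facts Ribet–DDT additive drop, Skinner–Urban 3.6.4 (ram) [flag SU14-12.3.6 @3 — the referee counts no closure through it], Carayol–Livné
join the bundle; r4's stub is DERIVED (`stub_memberRatEqAtThree_of_r5`).  Registered stubs after r5 (6 ≤ stubs_max): `stub_twinMuAn` (= 19948) |
`stub_muAnSurjDeepFive` | `stub_memberRatEqAtThree_offKodaira` | `stub_chainFactsLower` (12 named facts) | `stub_pubFactsLower` (= 19949).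
CELL READING after r5, modulo named published facts and K2's items 19948/19949: crux L = [Greenberg μ^an on the deep SURJECTIVE X11a pairs at
p ≥ 5] + [Wan-type rational equality at one 3-ordinary member OFF the Kodaira sub-locus at p = 3 (357/448 deep classes in range: 71 finite
flat at 3 — a weight-two partner road exists in print modulo typing, er5-p2 g3 §6 —, 286 très ramifié — the open core)].  The composition
`X11aLowerHalf_of` is unchanged (er5-p2 g2 p616834).  BSD is not proved by any of this.

RESHAPE r4 (lead, 2026-08-28T08:4xZ true clock, «p = 3 through the odd-prime chain»): width seat er5-p2 g2 landed the
odd-prime Hida chain (p612190 EPW `_odd` Literature instances, p614124 OddPrimeChain, p615198 OddPrimeDefs, p615570 OddPrimeDoors,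
p616834 OddPrimeStub) and x11a-p2 g2 landed Greenberg's analytic μ₃ = 0 at a MULTIPLICATIVE 3 for irreducible E[3] (p614543,
`MultThreeMuAn.muAnZeroAt_three_of_mult_of_irr`, modulo Mazur's Manin constant = conjunct 9 of 19949).  With them the p = 3
remainder `stub_lowerThreeDeep` is DERIVED (`stub_lowerThreeDeep_of_r4`) from ONE new per-pair statement:
`stub_memberRatEqAtThree` — at every deep X11a pair with p = 3, SOME ordinary Hida member g ≡ f_E of level prime to 3 carries the
RATIONAL cyclotomic equality (`OddChain.MemberRatEqAt W 3`; X. Wan's Thm. 4 conclusion at the member — PRINTED only for p ≥ 5,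
where `OddChain.memberRatEqAt_of_wan_of_five_le` discharges it).  Registered stubs after r4: `stub_muAnDeepFive` (Greenberg μ^an
on deep X11a at p ≥ 5) | `stub_memberRatEqAtThree` (Wan-type rational equality at p = 3) | `stub_chainFactsLower` (8 named facts:
EPW odd ×3, Wan-irred, Deligne–Serre, Hida, Kato–Wuthrich A32, Wuthrich Lemma 20) | `stub_pubFactsLower` (= 19949).  Composition =
er5-p2 g2's `OddChain.x11aLowerHalf_body_of_muAnFive_mazur_memberRatEqAtThree_of_facts`.  READING: modulo named published facts,
crux L = [Greenberg's analytic μ-conjecture on the deep X11a pairs at p ≥ 5] + [Wan's rational equality at ONE Hida member for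
the deep X11a pairs at p = 3]; the analytic μ at p = 3 is a THEOREM of the tree (x11a-p2 g2).

RESHAPE r3 (lead, 2026-08-28T08:0xZ, «one analytic residual at p ≥ 5»): er5-p2's last landing p610393
(`NonSurjChain.x11aLowerHalf_body_of_three_of_forall_muAnZeroAt_of_facts`) derives the WHOLE crux body from 17 named facts +
Greenberg–Stevens + ONE ∀-certificate «μ^an(E,p) = 0 at every deep X11a pair with p ≥ 5» (BOTH image types: surjective side =
the x11a chain of record `X11a.forall_bsdp_of_namedFacts_ofLevel_heightFree` — rational Wan Thm 4 at a Hida member + EPW transport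
+ the certificate — with Wan fed from the (irred) instance; non-surjective side = p609759) + the `p = 3` off-unit remainder.  The
registered stubs are therefore RE-CUT to exactly that: `stub_muAnDeepFive` (Greenberg's analytic μ-conjecture on the deep X11a
locus at p ≥ 5 — OPEN class-wide, a finite modular-symbol certificate PER PAIR), `stub_lowerThreeDeep` (the lower half at the deep
X11a pairs with p = 3, both images — OPEN, no Hida chain typed at 3; 435 three-descent records per pair), and the two fact
bundles `stub_chainFactsLower` (EPW ×3, Wan-irred, Deligne–Serre, Hida, Kato–Wuthrich A32) and `stub_pubFactsLower` (= 19949).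
The r1/r2 stubs are DERIVED in-file (`stub_lowerSurjDeep_of_r3`, `stub_lowerNonSurjDeep_of_r3`).  Reading: modulo named facts,
crux L (19064) at p ≥ 5, crux U5 (20614) and K2's corner twins (19948) are ALL instances of Greenberg's Conj. 1.11 on X11a.

RESHAPE r2 (lead, 2026-08-28T07:3xZ, «¬Surj through K2's twin certificate»): width seat bsd-line-er5-p2 (-w3) landed
the Hida-family chain WITHOUT surjectivity (p607778 NonSurjEndpoint, p609418 NonSurjChain, p609759 NonSurjDoors; Literature
instance p608784 `Wan2015.thm4_rational_weightK_member_of_bdd_ofLevel_irred`): at a non-surjective X11a pair with `p ≥ 5`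
(hence `p ∈ {5,7}`, BDMTV) the lower half follows from the analytic certificate `μ^an(E,p) = 0` and named facts. The
registered ¬Surj stub is therefore CUT into: `stub_twinMuAn` = bsd-stepL's crux item 19948
`Theorems.NonSurjCornerTwinMuAn` BY NAME (the certificate on the whole non-surjective X11a locus at `p ∈ {5,7}` —
Greenberg's Conj. 1.11 there; OPEN class-wide, per-pair a finite modular-symbol computation), the fact bundles
`stub_pubFactsLower` (= item 19949 `KatoTwinFactsFiveAn` BY NAME) and `stub_hidaFactsLower` (the six Hida-family facts of
the chain + BDMTV Thm. 1.2, named Literature facts), and the raw `p = 3` remainder `stub_lowerNonSurjThreeDeep` (images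
3Ns/3Nn; no chain typed at `p = 3`). Consequence: on ¬Surj ∧ p ≥ 5 this crux and the Euler half U5 (20614) / K2's corner
(19065) have ONE shared open input, item 19948.

THE LINE. The crux `∀ (W,p) ∈ X11a, ord_p #Ш(E)_an ≤ ord_p #Ш(E)` (the main-conjecture / Eisenstein half
of Miller's `BSD(E,p)` at a rank-0 multiplicative irreducible odd prime WITHOUT Skinner–Urban's auxiliary
ramified prime) is cut by the image of `ρ̄_{E,p}`, off the unit pairs:
* `stub_lowerSurjDeep`    — surjective image, `p ∣ #Ш_an` (for `p ≥ 5` EQUIVALENT to `BSD(E,p)` on that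
  sub-leaf given Wuthrich 2014 Prop. 21 + GZK + modularity, tree `X11a.bsdp_iff_missingLowerBoundAt_of_surj`;
  IMC-grade: SU 2014 Thm 3.6.4 / Skinner 2016 Thm C without (ram) — barrier B3 «no-ram»; OPEN class-wide;
  residual of record of road p1 = integral Eisenstein inclusions of the weight-`k_m > 2` Hida members
  (P1-ROAD §2–§4, watch-list w1–w3 not in print); per-pair E1 instruments in the kernel: Kim-deep Kurihara
  certificates (all 6 Tamagawa-defect pairs @5), μ-transport to a BCS good-ordinary partner (peu-ramifié
  pairs), 3-descent @3 (424 records), visibility @5/@7 (94 pairs); census: 158 deep surjective pairs with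
  N < 5·10⁵, 158 closed PER PAIR, 0 class-wide);
* `stub_lowerNonSurjDeep` — non-surjective irreducible image (`p ∈ {3,5,7}`, `p ∣ ord_p Δ_min`), `p ∣ #Ш_an`
  (rung K6's object: Greenberg μ = 0 / Mazur MC lower bound at a small irreducible image; OPEN class-wide;
  census @5: all 56 known pairs with N < 5·10⁵ are unit pairs — NO known instance of this stub's hypothesis
  at p ≥ 5; @3: 11 three-descent lower-half records (p2 lane); the sub-locus bsd-stepL's `NonSurjCorner`
  hybrid consumes through ER5's binder h₃, REF g13 `StepLCarry19064`).

References: [Skinner2016PacificMC] Thm. C; [SkinnerUrban2014] Thm. 3.6.4 (hyp. (ram));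
[arXiv:2405.00270] (BCS, good p only); [Wuthrich2014] Prop. 21; [GreenbergLNM1716] Conj. 1.11;
[Miller2011LMS] Def. 1.1.
-/

set_option linter.dupNamespace false
set_option autoImplicit false

noncomputable section

open scoped Classical MatrixGroups ModularForm

open WeierstrassCurve Literature.NumberTheory.EllipticCurves
  Literature.NumberTheory.EllipticCurves.ModularForms
  Literature.NumberTheory.EllipticCurves.Rank1Residual
  Literature.NumberTheory.EllipticCurves.Rank1Residual.Typed
  Literature.NumberTheory.EllipticCurves.Wuthrich2014
  Literature.NumberTheory.EllipticCurves.SteinWuthrich2013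
  Literature.NumberTheory.EllipticCurves.Greenberg1999
  Literature.NumberTheory.EllipticCurves.Kato2004
  Literature.NumberTheory.EllipticCurves.BalakrishnanEtAl2019
  Literature.NumberTheory.EllipticCurves.SkinnerUrban2014
  Summit.BirchSwinnertonDyer.Rank1Residual

namespace Summit.BirchSwinnertonDyer.BirchSwinnertonDyer.Cruxes.X11aLowerHalf.Birth

/-- **stub (r17, unchanged at r18; OPEN class-wide; hardest; THE research statement of the line since r18 — the `p ≥ 5` child in
MAZUR-MAIN-CONJECTURE currency; the `p = 3` analogue now lives inside item 23178, `stub_x11aLowerHalfAtThree` below)**: at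
every DEEP X11a pair with `p ≥ 5` (`#Ш(E)_an` not a `p`-adic unit), BOTH images of `ρ̄_{E,p}`, MAZUR'S CYCLOTOMIC MAIN CONJECTURE holds for `E`
itself at the multiplicative prime `p` (`X2.MazurMainConjectureAt W p`, `Rank1Residual/X2/Cells.lean`: for the cyclotomic `ℤ_p`-extension, every
newform `f` of `W`, every period ratio `ϖ` and every Pontryagin-dual datum of `Sel_{p^∞}(E/ℚ_∞)` — `X(E/ℚ_∞)` is `Λ`-torsion and `char_Λ X = (g)` with
`g · w = ϖ · L_p(E)` for a unit `w`, the trivial-zero factor `T` inserted at a split prime; Néron-normalised; verbatim the conclusion of Skinner 2016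
Thm. A, which is printed under (irr) + (ram) — and X11a has no (ram) prime by definition).  Routed to the lower half through the FIVE-fact door
`ClassX11a.missingLowerBoundAt_of_mazurMainConjectureAt_of_facts` (modularity, Stein–Wuthrich 6.1 ×2, GZK, Greenberg–Stevens at the pair; no EPW ∕
Wan ∕ Deligne–Serre ∕ Hida ∕ Kato instance).  r3–r16 displayed this locus in GREENBERG-μ currency (`stub_muAnDeepFive`: some coefficient of the
Néron-normalised Mazur–Tate–Teitelbaum function is a `p`-adic unit, Conj. 1.11); that text IMPLIES this one modulo facts r16 displayed
(`stub_mazurMCAtDeepFive_of_muAnDeepFive` below: Wan's member + EPW transport + A32 ∕ the `_contra` packages), so the re-cut is monotone and every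
per-pair `μ`-certificate (158 ∕ 158 deep surjective pairs with `N < 5·10⁵`; no deep non-surjective X11a pair known in that range) still gives
Mazur's statement at its pair; and on the SURJECTIVE locus this text is EQUIVALENT to the crux restricted there modulo A32, Stein–Wuthrich 6.1 ×2,
GZK, modularity, Greenberg–Stevens (`Theorems.Birth.mazurMCAtSurjFive_iff_lowerSurjFive_of_facts`) — the weakest child a line can display.
SUFFICIENT conditions in print-shape: Greenberg's Conj. 1.11 + X. Wan Thm. 4 + EPW (the r16 road); a (ram)-free multiplicative analogue of Skinner
2016 Thm. A ∕ of Burungale–Castella–Skinner 2025 (good `p > 3` in print; the route's KILL-CRITERIA pivot «BCS §5 programme»).  On the surjective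
locus Kato–Wuthrich A32 already gives `char ∣ L_p` integrally, so the open content is ONE divisibility.  A research statement, displayed as a
stub, never as a fact; NOT in print.  [cite: Skinner2016PacificMC, Thm. A (§1) with §3.2–3.3 (shape; printed under (irr)+(ram))]
[cite: MazurTateTeitelbaum1986Invent, §I.14 (shape only)] [cite: GreenbergLNM1716, §1 Conj. 1.11 (p. 61)] [cite: Wan2015, Thm. 4 (pp. 4–5)]
[cite: Wuthrich2014, Thm. 3 (p. 382), Cor. 19 (p. 399)] -/
theorem stub_mazurMCAtDeepFive :
    ∀ (W : WeierstrassCurve ℚ) [W.IsElliptic] [W.IsGloballyMinimal] (p : ℕ) [Fact p.Prime],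
      ClassX11a W p → 5 ≤ p → ¬ X11a.ShaAnUnit W p → X2.MazurMainConjectureAt W p := by
  sorry

/-- **stub (r18; NEW; = item stmt-BirchSwinnertonDyer-23178 `X11aLowerHalfAtThree` — its text VERBATIM; stub ≡ item)**: crux L READ AT
`p = 3` — for every globally minimal `V` of class X11a at `3` (`r_an = 0`, `3 ‖ N`, `E[3]` irreducible, no (ram) prime), the main-conjecture
(lower) half `ord₃ #Ш(E)_an ≤ ord₃ #Ш(E)` (`Typed.MissingLowerBoundAt V 3`).  Filed by planner bsd-stepL g42 (RULING 73 (d), 2026-08-28T19:11Z)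
on routes `ClassRecordThree` ∕ `KolyvaginRoadThree` as the registered stub of crux 19109's line inert r20, «so that the two halves of 19064 live
where they are consumed».  EQUIVALENT (pure logic, `Theorems.Birth.lowerAtThree_iff_threeDeep`) to the cell's guarded binder `∀ W p, ClassX11a W p →
p = 3 → ¬ X11a.ShaAnUnit W p → MissingLowerBoundAt W p` (unit pairs free).  r17's `p = 3` branch PROVES it modulo r17's `p = 3` children
(`stub_x11aLowerHalfAtThree_of_r17` below; = `Theorems.Birth.lowerAtThree_of_children_r17_three`, whose by-name twin is that item's planner turnkey): finite flat at
`3` — the Hesse-pencil partner (fact-free) + EPW Cor. 5.1.4 ∕ Yan–Zhu 4.9 ∕ EPW Thm. 1 alg with Kato–Wuthrich A32, THEOREM B inside; très ramifié —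
Mazur's cyclotomic main conjecture at the pair (OPEN; printed only under (ram), Skinner 2016 Thm. A) through the five-fact door.  OPEN class-wide
through that research statement; an ITEM of two other routes, displayed here as a stub, never as a fact.
[cite: Miller2011LMS, Def. 1.1 (arXiv:1010.2431 p. 3)] [cite: Skinner2016PacificMC, Thm. A and Thm. C (shape; printed under (irr)+(ram))]
[cite: SkinnerUrban2014, Thm. 3.29 (shape only)] -/
theorem stub_x11aLowerHalfAtThree :
    ∀ (V : WeierstrassCurve ℚ) [V.IsElliptic] [V.IsGloballyMinimal], ClassX11a V 3 → MissingLowerBoundAt V 3 := by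
  sorry

/-- **r7 stub `stub_partnerThree` — DISCHARGED at r8 (a THEOREM; fact-free, class-wide)**: at every deep X11a pair with `p = 3`
OFF the Kodaira sub-locus whose `E[3]` is FINITE FLAT at `3` (`3 ∣ ord₃ Δ_min(E)`, peu ramifié), there is a globally minimal elliptic
curve `A/ℚ` with GOOD ORDINARY reduction at `3` and a `Γ_ℚ`-equivariant additive isomorphism `E[3] ≃ A[3]`.  Proof = the lead's
`Theorems.Birth.stub_partnerThree` (p632020), i.e. route UniversalToricDescent's
`exists_goodOrd_twin_of_mult_of_three_dvd_padicValInt` (explicit Hesse-pencil member; Fisher 2012 Thm. 13.2 proved in the tree) with the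
isomorphism inverted; only `Mult W 3` and the finite-flat hypothesis are used.  [cite: Fisher2012Hessian, Thm. 13.2 (n = 3)]
[cite: SilvermanAEC2009, V.4.1 (a) and VII.5 Prop. 5.1] -/
theorem stub_partnerThree :
    ∀ (W : WeierstrassCurve ℚ) [W.IsElliptic] [W.IsGloballyMinimal] (p : ℕ) [Fact p.Prime],
      ClassX11a W p → p = 3 → ¬ X11a.ShaAnUnit W p →
      ¬ (Surj W p ∧ ∃ v : IsDedekindDomain.HeightOneSpectrum ℤ, W.HasAdditiveReductionAt v ∧
          3 ∣ (W.kodairaSymbolAt v).componentGroupOrder ∧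
          ¬ Rat.HeightOneSpectrum.natGenerator v ^ 3 ∣ W.conductorNorm ℤ) →
      p ∣ padicValInt p W.minimalDiscriminantInt →
      ∃ (A : WeierstrassCurve ℚ) (_ : A.IsElliptic) (_ : A.IsGloballyMinimal),
        A.HasGoodReductionAtPrime p ∧ ¬ (p : ℤ) ∣ A.frobeniusTrace p ∧
        ∃ e : geomTorsion W (p : ℤ) ≃+ geomTorsion A (p : ℤ),
          ∀ (σ : Field.absoluteGaloisGroup ℚ) (P : geomTorsion W (p : ℤ)), e (σ • P) = σ • e P :=
  Summit.BirchSwinnertonDyer.BirchSwinnertonDyer.Theorems.Birth.stub_partnerThree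



/-- **stub (r20; ONE declared CITE stub — [CITE-ONLY — never a proof target, never benched]; director-bsd RESTUB SHAPE OF RECORD (390)(i),
2026-08-29T12:57Z)**: the FIVE print-exact statement-only named facts the composition `X11aLowerHalf_of` consumes (through width seat er5-p2 g14's p666636 §4
and its Greenberg-typed five-fact door `ClassX11a.missingLowerBoundAt_of_mazurMainConjectureAt_of_greenberg`), as ONE conjunction with the Literature decls
BY NAME inside, in p666636 §4's argument order: (1) MODULARITY "Version `L`" `exists_isNewformOf` (= the BODY of route `PrintX11a`'s input item
stmt-BirchSwinnertonDyer-19382 `NewformOfEllipticCurve`; read for the newform `f_E`, its entire `L`-function and the period ratio `ϖ`); (2) GREENBERG's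
rank-`0` formula at a SPLIT multiplicative prime, INPUTS row G104 `Greenberg1999.thm41Analogue_charValue_rankZero_split_baseChange_anyPrime` (LNM 1716 §4,
the passage following Thm. 4.1, pp. 111–112; D-audit FAITHFUL-as-specialisation; its rank-`0` slice is the tree THEOREM
`SteinWuthrich2013.clauses_rankZero_of_greenberg`, p662964); (3) GREENBERG's rank-`0` formula at a NON-SPLIT multiplicative prime, INPUTS row G103
`Greenberg1999.thm41Analogue_charValue_rankZero_numberField` (§4 after Prop. 4.8, pp. 112–113; FAITHFUL-as-weakening; slice p664420); (4) Gross–Zagier–Kolyvagin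
`rank_eq_analyticRank_of_analyticRank_le_one` (= the BODY of `PrintX11a`'s input item stmt-BirchSwinnertonDyer-19921 `RankEqAnalyticRankLeOne`); (5) the
EXCEPTIONAL-ZERO FORMULA at ODD primes `∀ W p, p ≠ 2 → greenberg_stevens` (Greenberg–Stevens 1993 for `p ≥ 5` ∕ Kobayashi 2006 Cor. 4.2 for odd `p` — the
printed scope; read only at a SPLIT multiplicative `p`).  r19 displayed these as five one-fact stubs (`stub_newformFact` | `stub_greenbergSplitRankZero` |
`stub_greenbergNonsplitRankZero` | `stub_gzkFactLower` | `stub_greenbergStevensOdd`), kept below as sorry-free PROJECTIONS of this stub so every consumer is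
byte-identical; r10–r18 displayed the SW-typed nine + GZK.  Conjuncts (2), (3), (5) are shared verbatim with U3's finemu3 r7 texts; (1), (4) with route
`PrintX11a`'s items 19382 ∕ 19921.  A bundle of named Literature facts (never 'proved' here; each conjunct closes by instantiation when its `_holds` lands —
none exists: 0 unconditional `_holds` for any of the five, LEAD g14 ∕ g16 conclusion-position census, bench wave 2026-08-29T11:3xZ 4 × BLOCKED).
[cite: BreuilConradDiamondTaylor2001, Thm. A] [cite: DiamondShurman2005, Thm. 8.8.3 (shape)]
[cite: GreenbergLNM1716, §4, the passage following Thm. 4.1 (pp. 111–112) and the passage following Prop. 4.8 (pp. 112–113)]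
[cite: SteinWuthrich2013, Thm. 6.1 (p. 20) (the slices rows G104 ∕ G103 yield)] [cite: GrossZagier1986, I.(7.3) (shape only)] [cite: Kolyvagin1990, Thm. A (shape only)]
[cite: GreenbergStevens1993, Thm. 3.14] [cite: Kobayashi2006DocMath, Cor. 4.2 (p. 575)] -/
theorem stub_printInputsLower :
    exists_isNewformOf ∧
    Greenberg1999.thm41Analogue_charValue_rankZero_split_baseChange_anyPrime ∧
    Greenberg1999.thm41Analogue_charValue_rankZero_numberField ∧
    rank_eq_analyticRank_of_analyticRank_le_one ∧
    (∀ (W : WeierstrassCurve ℚ) [W.IsElliptic] [W.IsGloballyMinimal] (p : ℕ) [Fact p.Prime],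
      p ≠ 2 → greenberg_stevens (W := W) (p := p)) := by
  sorry

/-- **r19's `stub_newformFact` — since r20 a PROJECTION THEOREM (conjunct 1 of the cite stub `stub_printInputsLower`; no `sorry` of its own)**:
MODULARITY "Version `L`", every elliptic curve over `ℚ` has a newform, `exists_isNewformOf` = the BODY of route `PrintX11a`'s input item
stmt-BirchSwinnertonDyer-19382 `NewformOfEllipticCurve` and the text of U5's registered stub `GL1Cartan.stub_newform` (gl1cartan5 rev 5–8), VERBATIM up to
namespace; read by the five-fact door for the newform `f_E`, its entire `L`-function and the period ratio `ϖ`.  A named Literature fact (never 'proved' here).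
[cite: BreuilConradDiamondTaylor2001, Thm. A] [cite: DiamondShurman2005, Thm. 8.8.3 (shape)] -/
theorem stub_newformFact :
    exists_isNewformOf :=
  stub_printInputsLower.1

/-- **r19's `stub_greenbergStevensOdd` — since r20 a PROJECTION THEOREM (conjunct 5 of the cite stub `stub_printInputsLower`; no `sorry` of its own)**: the
EXCEPTIONAL-ZERO FORMULA at ODD primes — Greenberg–Stevens 1993 (`p ≥ 5`) ∕ Kobayashi 2006 Cor. 4.2 (odd `p`), `∀ W p, p ≠ 2 → greenberg_stevens` — the
printed scope; conjunct 3 of r10–r18's shared nine and of U3's finemu3 r6 ∕ r7 VERBATIM; read by the five-fact door ONLY at a SPLIT multiplicative `p`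
(`[T¹]L_p · log_p κ(γ) = 𝓛_p · [0]⁺_f`).  A named Literature fact (never 'proved' here).  [cite: GreenbergStevens1993, Thm. 3.14] [cite: Kobayashi2006DocMath, Cor. 4.2 (p. 575)] -/
theorem stub_greenbergStevensOdd :
    ∀ (W : WeierstrassCurve ℚ) [W.IsElliptic] [W.IsGloballyMinimal] (p : ℕ) [Fact p.Prime],
      p ≠ 2 → greenberg_stevens (W := W) (p := p) :=
  stub_printInputsLower.2.2.2.2

/-- **r19's `stub_greenbergSplitRankZero` — since r20 a PROJECTION THEOREM (conjunct 2 of the cite stub `stub_printInputsLower`; no `sorry` of its own)**: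
GREENBERG's rank-`0` formula at a SPLIT multiplicative prime, INPUTS row G104 `Greenberg1999.thm41Analogue_charValue_rankZero_split_baseChange_anyPrime` (LNM 1716
§4, the passage following Thm. 4.1, held PDF pp. 111–112: `f_E(0)·#E(F)(p)² ∼ (∏_{v∣p} l_v)(∏ c_v^{(p)})·#Sel`, `l_v = 𝓛_p/(2p)` at a split `v`; D-audit
FAITHFUL-as-specialisation, INPUTS-LIST-2-ADDENDUM-37 §G); shared VERBATIM with U3's finemu3 r7; its rank-`0` slice is the tree THEOREM
`SteinWuthrich2013.clauses_rankZero_of_greenberg` (p662964).  A named Literature fact (never 'proved' here).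
[cite: GreenbergLNM1716, §4, the passage following Thm. 4.1 (pp. 111–112)] [cite: SteinWuthrich2013, Thm. 6.1 (p. 20) (the slice it yields)] -/
theorem stub_greenbergSplitRankZero :
    Greenberg1999.thm41Analogue_charValue_rankZero_split_baseChange_anyPrime :=
  stub_printInputsLower.2.1

/-- **r19's `stub_greenbergNonsplitRankZero` — since r20 a PROJECTION THEOREM (conjunct 3 of the cite stub `stub_printInputsLower`; no `sorry` of its own)**:
GREENBERG's rank-`0` formula at a NON-SPLIT multiplicative prime (`p` odd, `l_v ∼ 2`), INPUTS row G103 `Greenberg1999.thm41Analogue_charValue_rankZero_numberField`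
(LNM 1716 §4, after Prop. 4.8, held chunks p0112 L3–7 ∕ p0113 L1–5; D-audit FAITHFUL-as-weakening, INPUTS-LIST-2-ADDENDUM-37 §G); shared VERBATIM with U3's
finemu3 r7; its rank-`0` slice is the tree THEOREM `SteinWuthrich2013.thm61_nonsplitMultiplicative_clauses_rankZero_of_greenberg` (p664420).  A named
Literature fact (never 'proved' here).  [cite: GreenbergLNM1716, §4, the passage following Prop. 4.8 ("the analogue of theorem 4.1", pp. 112–113)] -/
theorem stub_greenbergNonsplitRankZero :
    Greenberg1999.thm41Analogue_charValue_rankZero_numberField :=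
  stub_printInputsLower.2.2.1

/-- **r19's `stub_gzkFactLower` — since r20 a PROJECTION THEOREM (conjunct 4 of the cite stub `stub_printInputsLower`; no `sorry` of its own)**:
Gross–Zagier–Kolyvagin, `rank E(ℚ) = r_an` and `Ш(E/ℚ)` finite when `r_an ≤ 1` (`rank_eq_analyticRank_of_analyticRank_le_one`) = the BODY of route
`PrintX11a`'s input item stmt-BirchSwinnertonDyer-19921 `RankEqAnalyticRankLeOne`, VERBATIM; consumed by the five-fact door at every deep pair with `p ≥ 5`
(it turns Mazur's statement + the interpolation facts into the Miller half); also a hypothesis of `stub_x11aLowerHalfAtThree_of_r17` and of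
`stub_mazurMCAtSurjFive_of_baseChangeLowerBound` below.  A named Literature fact (never 'proved' here).
[cite: GrossZagier1986, I.(7.3) (shape only)] [cite: Kolyvagin1990, Thm. A (shape only)] -/
theorem stub_gzkFactLower :
    rank_eq_analyticRank_of_analyticRank_le_one :=
  stub_printInputsLower.2.2.2.1

/-- **MONOTONICITY of the r18 re-cut (registration history; a THEOREM, no `sorry`)**: r17's `p = 3` children — Kato–Wuthrich A32 (`hA32`,
conjunct 1 of r17's `stub_katoGZKFactsLower`), the three partner facts (`hQ3` = r17's `stub_threePartnerFactsLower` verbatim: EPW Cor. 5.1.4,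
Yan–Zhu Thm. 4.9, EPW Thm. 1 alg) and Mazur's cyclotomic main conjecture at the très-ramifié deep X11a pairs at `3` (`hMC3` = r17's
`stub_mazurMCAtTresRamifieThree` verbatim; OPEN) —, with the shared nine and GZK still on the line, IMPLY the r18 stub `stub_x11aLowerHalfAtThree`
(item 23178's text): the lead's `Theorems.Birth.lowerAtThree_of_children_r17_three` (p663752; body = p646859's
`ThreePartner.lowerThreeDeep_of_partnerFF_of_mazurTR_of_facts`, reshaped to the literal prime).  So every proof of r17's `p = 3` texts closes the
r18 stub: the re-cut loses no road.  [cite: EmertonPollackWeston2006, Thm. 1, Cor. 5.1.4] [cite: YanZhu2024MainConjNonCM, Thm. 4.9]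
[cite: Wuthrich2014, Thm. 3 (p. 382), Lemma 20 (p. 400)] [cite: MazurTateTeitelbaum1986Invent, §I.14 (shape only)] -/
theorem stub_x11aLowerHalfAtThree_of_r17
    (hA32 : Wuthrich2014.kato_charIdeal_dvd_multiplicative_of_surjective)
    (hQ3 : EmertonPollackWeston2006.cor514_transfer_of_goodOrdinary_odd ∧ YanZhu2026.thm49_charIdeal_eq_padicLFunction ∧
      EmertonPollackWeston2006.thm1_muAlg_transfer_goodOrdinary_of_mult_odd)
    (hMC3 : ∀ (W : WeierstrassCurve ℚ) [W.IsElliptic] [W.IsGloballyMinimal] (p : ℕ) [Fact p.Prime],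
      ClassX11a W p → p = 3 → ¬ X11a.ShaAnUnit W p → ¬ p ∣ padicValInt p W.minimalDiscriminantInt →
      X2.MazurMainConjectureAt W p)
    (h9 : thm61_splitMultiplicative ∧ thm61_nonsplitMultiplicative ∧
      (∀ (W : WeierstrassCurve ℚ) [W.IsElliptic] [W.IsGloballyMinimal] (p : ℕ) [Fact p.Prime],
        p ≠ 2 → greenberg_stevens (W := W) (p := p)) ∧
      Kato2004.thm12_4 ∧ exists_isNewformOf ∧
      Kato2004.exists_multDivisibilityInputs_nonsplit_contra ∧
      Kato2004.exists_multDivisibilityInputs_split_contra ∧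
      Kato2004.exists_multDivisibilityInputs_fine_contra ∧ mazur_not_dvd_maninConstant_of_odd) :
    ∀ (V : WeierstrassCurve ℚ) [V.IsElliptic] [V.IsGloballyMinimal], ClassX11a V 3 → MissingLowerBoundAt V 3 :=
  Summit.BirchSwinnertonDyer.BirchSwinnertonDyer.Theorems.Birth.lowerAtThree_of_children_r17_three
    h9 ⟨hA32, stub_gzkFactLower⟩ hQ3 hMC3


/-- **MONOTONICITY of the r17 re-cut (registration history; a THEOREM, no `sorry`)**: the r3–r16 registered `p ≥ 5` text `stub_muAnDeepFive`
(Greenberg-μ currency, here the HYPOTHESIS `hμ5`, verbatim) + seven of r16's eight chain facts (`h7L` = EPW 3.1.1 ∕ Thm. 1 alg ∕ X. Wan Thm. 4 ∕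
EPW 5.1.3 ∕ Deligne–Serre 6.1 ∕ Hida 3.26 ∕ Kato–Wuthrich A32, r16's order without GZK; Wan supplies the member, EPW the transport) + the shared
nine IMPLY the r17 registered text `stub_mazurMCAtDeepFive` — by the lead's `Theorems.Birth.mazurMCAtDeepFive_of_muAnDeepFive_of_facts` (surjective
image: Serre + A32; non-surjective: Kato 12.4 + §17.13 `_contra` ×3 + Mazur 4.1).  So every proof of the r16 text closes the r17 stub: the re-cut loses
no road.  [cite: GreenbergLNM1716, §1 Conj. 1.11 (p. 61)] [cite: Wan2015, Thm. 4 (pp. 4–5)] [cite: EmertonPollackWeston2006, Thm. 3.1.1, Thm. 1, Thm. 5.1.3]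
[cite: Kato2004Asterisque, Thm. 12.4 (p. 221), §17.13 (pp. 279–280)] -/
theorem stub_mazurMCAtDeepFive_of_muAnDeepFive
    (h7L : EmertonPollackWeston2006.thm311_cotorsion_weightK_member_ofLevel_odd ∧
      EmertonPollackWeston2006.thm1_muAlg_of_weightK_member_ofLevel_odd ∧
      Wan2015.thm4_rational_weightK_member_of_bdd_ofLevel_irred ∧
      EmertonPollackWeston2006.thm513_transfer_from_weightK_member_of_bdd_ofLevel_odd ∧
      ModularForms.DeligneSerre1974.thm61_exists_adicGaloisRep ∧
      Hida2000_thm326_ordinary ∧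
      Wuthrich2014.kato_charIdeal_dvd_multiplicative_of_surjective)
    (hμ5 : ∀ (W : WeierstrassCurve ℚ) [W.IsElliptic] [W.IsGloballyMinimal] (p : ℕ) [Fact p.Prime],
      ClassX11a W p → 5 ≤ p → ¬ X11a.ShaAnUnit W p → X11a.MuAnZeroAt W p)
    (h9 : thm61_splitMultiplicative ∧ thm61_nonsplitMultiplicative ∧
      (∀ (W : WeierstrassCurve ℚ) [W.IsElliptic] [W.IsGloballyMinimal] (p : ℕ) [Fact p.Prime],
        p ≠ 2 → greenberg_stevens (W := W) (p := p)) ∧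
      Kato2004.thm12_4 ∧ exists_isNewformOf ∧
      Kato2004.exists_multDivisibilityInputs_nonsplit_contra ∧
      Kato2004.exists_multDivisibilityInputs_split_contra ∧
      Kato2004.exists_multDivisibilityInputs_fine_contra ∧ mazur_not_dvd_maninConstant_of_odd) :
    ∀ (W : WeierstrassCurve ℚ) [W.IsElliptic] [W.IsGloballyMinimal] (p : ℕ) [Fact p.Prime],
      ClassX11a W p → 5 ≤ p → ¬ X11a.ShaAnUnit W p → X2.MazurMainConjectureAt W p :=
  Summit.BirchSwinnertonDyer.BirchSwinnertonDyer.Theorems.Birth.mazurMCAtDeepFive_of_muAnDeepFive_of_facts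
    h9 h7L hμ5

/-- **A SECOND door into the r17 `p ≥ 5` stub, on its SURJECTIVE sub-locus (a THEOREM, no `sorry`; the route's KILL-CRITERIA pivot typed)**:
the Burungale–Castella–Skinner base-change display (5.3) read INTEGRALLY at the multiplicative prime (`X11a.BaseChangeLowerBoundAt W p`,
`Rank1Residual/X11a/BaseChangeRoute.lean` — an OPEN typed input, printed only at good ordinary `p > 3`; the hypothesis `hBC` here) at every deep
SURJECTIVE X11a pair with `p ≥ 5`, plus Kato–Wuthrich A32 (the hypothesis `hKato`; on the line until r17 as conjunct 1 of `stub_katoGZKFactsLower`) and modularity (from the shared nine, for the period ratios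
of the three twists), gives Mazur's statement there — the tree's `X11a.mazurMainConjectureAt_of_baseChangeLowerBound`.  So on the surjective locus
the r17 child has TWO typed sufficient conditions (Greenberg's μ-text via `stub_mazurMCAtDeepFive_of_muAnDeepFive`; the base-change display via this
theorem) and is EQUIVALENT to the crux there (`Theorems.Birth.mazurMCAtSurjFive_iff_lowerSurjFive_of_facts`); on the non-surjective deep locus
(`p ∈ {5,7}`, finite flat at `p`) only the μ-road is typed.  CONDITIONAL; displays a sufficient condition, asserts nothing.
[cite: BurungaleCastellaSkinner2025, "Proof of Theorem 1.1.2" with (5.3) (arXiv:2405.00270v2 p. 10) (shape; printed at good ordinary p only)]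
[cite: Wuthrich2014, Thm. 3 (p. 383) and Cor. 19 (pp. 398–399)] [cite: Skinner2016PacificMC, §3.2–3.3 (shape only)] -/
theorem stub_mazurMCAtSurjFive_of_baseChangeLowerBound
    (hKato : Wuthrich2014.kato_charIdeal_dvd_multiplicative_of_surjective)
    (hBC : ∀ (W : WeierstrassCurve ℚ) [W.IsElliptic] [W.IsGloballyMinimal] (p : ℕ) [Fact p.Prime],
      ClassX11a W p → 5 ≤ p → Surj W p → ¬ X11a.ShaAnUnit W p → X11a.BaseChangeLowerBoundAt W p) :
    ∀ (W : WeierstrassCurve ℚ) [W.IsElliptic] [W.IsGloballyMinimal] (p : ℕ) [Fact p.Prime],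
      ClassX11a W p → 5 ≤ p → Surj W p → ¬ X11a.ShaAnUnit W p → X2.MazurMainConjectureAt W p := by
  have hNf : exists_isNewformOf := stub_newformFact
  intro W _ _ p _ hX hp5 hs hu
  exact X11a.mazurMainConjectureAt_of_baseChangeLowerBound W p hKato
    (nonempty_modularParametrizationData_of_exists_isNewformOf hNf IsNewformOf.exists_maninConstant_ne_zero_holds)
    hp5 hX.mult hs (hBC W p hX hp5 hs hu)

/-- **MONOTONICITY of the r15 re-cut (registration history; a THEOREM, no `sorry`)**: the r12–r14 registered text
`stub_memberRatEqAtTresRamifieThree` (member currency, here the HYPOTHESIS `hM`, verbatim) IMPLIES the r15 registered text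
`stub_mazurMCAtTresRamifieThree` modulo facts r14 displayed — modularity and Mazur Cor. 4.1 from the shared nine, EPW 3.1.1 ∕ Thm. 1 alg ∕
5.1.3, Deligne–Serre 6.1, Hida 3.26, Kato–Wuthrich A32 from r14–r16's chain facts (since r17 the HYPOTHESIS `h7L`, r16's chain-eight minus GZK),
Greenberg–Stevens at odd primes from the nine, Wuthrich's Lemma 20 from the tree — by width seat er5-p2 g8's
`Theorems.Birth.mazurTR_of_memberTR_of_chainFacts`.  So every proof of the r14 text closes the r15 stub: the re-cut loses no road.  [cite: EmertonPollackWeston2006, Thm. 3.1.1, Thm. 1, Thm. 5.1.3] [cite: Wuthrich2014, Thm. 3, Lemma 20 (p. 399)]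
[cite: Mazur1978, Cor. 4.1] -/
theorem stub_mazurMCAtTresRamifieThree_of_memberTR
    (h7L : EmertonPollackWeston2006.thm311_cotorsion_weightK_member_ofLevel_odd ∧
      EmertonPollackWeston2006.thm1_muAlg_of_weightK_member_ofLevel_odd ∧
      Wan2015.thm4_rational_weightK_member_of_bdd_ofLevel_irred ∧
      EmertonPollackWeston2006.thm513_transfer_from_weightK_member_of_bdd_ofLevel_odd ∧
      ModularForms.DeligneSerre1974.thm61_exists_adicGaloisRep ∧
      Hida2000_thm326_ordinary ∧
      Wuthrich2014.kato_charIdeal_dvd_multiplicative_of_surjective)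
    (hM : ∀ (W : WeierstrassCurve ℚ) [W.IsElliptic] [W.IsGloballyMinimal] (p : ℕ) [Fact p.Prime],
      ClassX11a W p → p = 3 → ¬ X11a.ShaAnUnit W p →
      ¬ p ∣ padicValInt p W.minimalDiscriminantInt →
      Summit.BirchSwinnertonDyer.BirchSwinnertonDyer.Theorems.OddChain.MemberRatEqAt W p)
    (hMz : mazur_not_dvd_maninConstant_of_odd) :
    ∀ (W : WeierstrassCurve ℚ) [W.IsElliptic] [W.IsGloballyMinimal] (p : ℕ) [Fact p.Prime],
      ClassX11a W p → p = 3 → ¬ X11a.ShaAnUnit W p → ¬ p ∣ padicValInt p W.minimalDiscriminantInt →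
      X2.MazurMainConjectureAt W p := by
  have hGS := stub_greenbergStevensOdd
  have hNf : exists_isNewformOf := stub_newformFact
  obtain ⟨h311, hT1a, -, hT1b, h61, h326, hKato⟩ := h7L
  exact Summit.BirchSwinnertonDyer.BirchSwinnertonDyer.Theorems.Birth.mazurTR_of_memberTR_of_chainFacts
    hNf h311 hT1a hT1b h61 h326 hKato hGS hMz hM

/-- **r7's `stub_lowerTresRamifieThree` (the lower half on the très-ramifié off-Kodaira deep X11a locus at `3`) — a THEOREM since r12** (kept for
the registration history; no longer consumed by the composition since r14): at r18 := the RESTRICTION of `stub_x11aLowerHalfAtThree` (item 23178's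
text) through `Theorems.Birth.threeDeep_of_lowerAtThree` (pure logic); at r15–r17 := width seat er5-p2 g8's per-pair door
`ClassX11a.missingLowerBoundAt_of_mazurMainConjectureAt_of_facts` fed by modularity, Stein–Wuthrich 6.1 ×2 and Greenberg–Stevens AT THE PAIR
(`3 ≠ 2`) from the shared nine, GZK (from `stub_katoGZKFactsLower` since r17), and the r15 Mazur stub — FIVE facts, no EPW ∕ Deligne–Serre ∕ Hida ∕ Kato instance; the
off-Kodaira binder is simply not used.  [cite: SteinWuthrich2013, Thm. 6.1 (p. 20)] [cite: MazurTateTeitelbaum1986Invent, §I.14 (shape only)]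
[cite: Miller2011LMS, Def. 1.1] -/
theorem stub_lowerTresRamifieThree :
    ∀ (W : WeierstrassCurve ℚ) [W.IsElliptic] [W.IsGloballyMinimal] (p : ℕ) [Fact p.Prime],
      ClassX11a W p → p = 3 → ¬ X11a.ShaAnUnit W p →
      ¬ (Surj W p ∧ ∃ v : IsDedekindDomain.HeightOneSpectrum ℤ, W.HasAdditiveReductionAt v ∧
          3 ∣ (W.kodairaSymbolAt v).componentGroupOrder ∧
          ¬ Rat.HeightOneSpectrum.natGenerator v ^ 3 ∣ W.conductorNorm ℤ) →
      ¬ p ∣ padicValInt p W.minimalDiscriminantInt → MissingLowerBoundAt W p := by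
  intro W _ _ p _ hX hp3 hu _ _
  exact Summit.BirchSwinnertonDyer.BirchSwinnertonDyer.Theorems.Birth.threeDeep_of_lowerAtThree
    stub_x11aLowerHalfAtThree W p hX hp3 hu

/-! ## r6 ∕ r16-M ∕ r17: the r4 `∀`-stub `stub_muAnDeepFive` was DERIVED at r5–r15 from item 19948 (non-surjective side, modulo BDMTV) and
`stub_muAnSurjDeepFive`; at r16-M it was the registered stub again; at r17 it LEAVES the skeleton (re-cut to `stub_mazurMCAtDeepFive`, of which it
is a sufficient condition: `stub_mazurMCAtDeepFive_of_muAnDeepFive`). -/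

/-! ## The earlier stubs, DERIVED from the r4 stubs (real proofs; continuity of the registration history) -/

/-- **The r3 stub `stub_lowerThreeDeep` (lower half at the deep X11a pairs with `p = 3`, both images) from the r4 stubs** —
er5-p2 g2's `OddChain.lowerThreeDeep_of_mazur_of_forall_memberRatEqAt_of_facts` (p616834): the odd-prime chain at `3` with the
analytic certificate DISCHARGED by x11a-p2 g2's `MultThreeMuAn.muAnZeroAt_three_of_mult_of_irr` (Mazur's Manin constant =
conjunct 9 of the K2 bundle). [cite: EmertonPollackWeston2006, Thm. 5.1.3] [cite: Mazur1978, Cor. 4.1] [cite: GreenbergLNM1716, Conj. 1.11] -/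
theorem stub_lowerThreeDeep_of_r4
    (hC : EmertonPollackWeston2006.thm311_cotorsion_weightK_member_ofLevel_odd ∧
      EmertonPollackWeston2006.thm1_muAlg_of_weightK_member_ofLevel_odd ∧
      Wan2015.thm4_rational_weightK_member_of_bdd_ofLevel_irred ∧
      EmertonPollackWeston2006.thm513_transfer_from_weightK_member_of_bdd_ofLevel_odd ∧
      ModularForms.DeligneSerre1974.thm61_exists_adicGaloisRep ∧
      Hida2000_thm326_ordinary ∧
      Wuthrich2014.kato_charIdeal_dvd_multiplicative_of_surjective ∧
      Wuthrich2014.lemma20_surjective_threeAdic_of_semistable ∧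
      thm12_not_le_normalizer_splitCartan ∧
      ribet1990_levelLowering_gamma0_newform_at_three_additiveDrop ∧
      thm364_rational_weightK_member_of_bdd_ofLevel_ram ∧
      carayolLivne_additivePrime_dvd_level_of_congruent_newform)
    (hF : Summit.BirchSwinnertonDyer.BirchSwinnertonDyer.Theses.ErratumRoadFive.KatoTwinFactsFiveAn)
    (hmem : ∀ (W : WeierstrassCurve ℚ) [W.IsElliptic] [W.IsGloballyMinimal] (p : ℕ) [Fact p.Prime],
      ClassX11a W p → p = 3 → ¬ X11a.ShaAnUnit W p → Summit.BirchSwinnertonDyer.BirchSwinnertonDyer.Theorems.OddChain.MemberRatEqAt W p) :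
    ∀ (W : WeierstrassCurve ℚ) [W.IsElliptic] [W.IsGloballyMinimal] (p : ℕ) [Fact p.Prime],
      ClassX11a W p → p = 3 → ¬ X11a.ShaAnUnit W p → MissingLowerBoundAt W p := by
  obtain ⟨h311, hT1a, -, hT1b, h61, h326, hKato, h20, -⟩ := hC
  obtain ⟨-, -, -, hGZK, -, hNf, -, -, hMz, -, -, hJs, hJn, hGS, -, -, -, h12, hnsI, hspI, h15, h18, hfine⟩ := hF
  exact Summit.BirchSwinnertonDyer.BirchSwinnertonDyer.Theorems.OddChain.lowerThreeDeep_of_mazur_of_forall_memberRatEqAt_of_facts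
    hNf h311 hT1a hT1b h61 h326 hKato h20 h12 hnsI hspI h15 h18 hfine hJs hJn hGZK hGS hMz hmem

/-- The crux body RESTRICTED to `p ≥ 5` (both images) from the r4 stubs — er5-p2's p610393 with the `5 ≤ p` EPW instances
obtained from the odd ones (`OddChain.thm311_ofLevel_of_odd` & co.). [cite: EmertonPollackWeston2006, Thm. 5.1.3] [cite: Wan2015, Thm. 4] -/
theorem lowerFive_of_r4
    (hC : EmertonPollackWeston2006.thm311_cotorsion_weightK_member_ofLevel_odd ∧
      EmertonPollackWeston2006.thm1_muAlg_of_weightK_member_ofLevel_odd ∧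
      Wan2015.thm4_rational_weightK_member_of_bdd_ofLevel_irred ∧
      EmertonPollackWeston2006.thm513_transfer_from_weightK_member_of_bdd_ofLevel_odd ∧
      ModularForms.DeligneSerre1974.thm61_exists_adicGaloisRep ∧
      Hida2000_thm326_ordinary ∧
      Wuthrich2014.kato_charIdeal_dvd_multiplicative_of_surjective ∧
      Wuthrich2014.lemma20_surjective_threeAdic_of_semistable ∧
      thm12_not_le_normalizer_splitCartan ∧
      ribet1990_levelLowering_gamma0_newform_at_three_additiveDrop ∧
      thm364_rational_weightK_member_of_bdd_ofLevel_ram ∧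
      carayolLivne_additivePrime_dvd_level_of_congruent_newform)
    (hF : Summit.BirchSwinnertonDyer.BirchSwinnertonDyer.Theses.ErratumRoadFive.KatoTwinFactsFiveAn)
    (hμ : ∀ (W : WeierstrassCurve ℚ) [W.IsElliptic] [W.IsGloballyMinimal] (p : ℕ) [Fact p.Prime],
      ClassX11a W p → 5 ≤ p → ¬ X11a.ShaAnUnit W p → X11a.MuAnZeroAt W p) :
    ∀ (W : WeierstrassCurve ℚ) [W.IsElliptic] [W.IsGloballyMinimal] (p : ℕ) [Fact p.Prime],
      ClassX11a W p → 5 ≤ p → MissingLowerBoundAt W p := by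
  obtain ⟨h311, hT1a, hT2, hT1b, h61, h326, hKato, -, -⟩ := hC
  obtain ⟨-, -, -, hGZK, -, hNf, -, -, -, -, -, hJs, hJn, hGS, -, -, -, h12, hnsI, hspI, h15, h18, hfine⟩ := hF
  exact Summit.BirchSwinnertonDyer.BirchSwinnertonDyer.Theorems.NonSurjChain.x11aLowerHalf_five_of_forall_muAnZeroAt_of_facts
    hNf (Summit.BirchSwinnertonDyer.BirchSwinnertonDyer.Theorems.OddChain.thm311_ofLevel_of_odd h311)
    (Summit.BirchSwinnertonDyer.BirchSwinnertonDyer.Theorems.OddChain.thm1_ofLevel_of_odd hT1a) hT2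
    (Summit.BirchSwinnertonDyer.BirchSwinnertonDyer.Theorems.OddChain.thm513_ofLevel_of_odd hT1b)
    h61 h326 hKato h12 hnsI hspI h15 h18 hfine hJs hJn hGZK hGS hμ

/-! ## Fact-free adapters (pure logic; any curve, any prime) -/

/-- On a unit pair (`#Ш(E)_an` a rational `p`-adic unit) the lower half `ord_p #Ш_an ≤ ord_p #Ш` holds outright:
`0 ≤ ord_p #Ш`. No fact, any model, any `p`. [cite: Miller2011LMS, Def. 1.1 (arXiv:1010.2431 p. 3)] -/
theorem missingLowerBoundAt_of_shaAnUnit (W : WeierstrassCurve ℚ) (p : ℕ) (h : X11a.ShaAnUnit W p) :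
    MissingLowerBoundAt W p := by
  obtain ⟨q, hq, hv⟩ := h
  exact ⟨q, hq, by rw [hv]; exact_mod_cast Nat.zero_le _⟩

/-- The registered birth stub `stub_lowerSurj` (c998db5e) is EQUIVALENT to its off-unit restriction
`stub_lowerSurjDeep` (pure logic) — the reshape adds and removes nothing provable. [cite: Miller2011LMS, Def. 1.1] -/
theorem stub_lowerSurj_iff_deep :
    (∀ (Wd : WeierstrassCurve ℚ) [Wd.IsElliptic] [Wd.IsGloballyMinimal] (p : ℕ) [Fact p.Prime],
        ClassX11a Wd p → Surj Wd p → MissingLowerBoundAt Wd p) ↔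
      ∀ (Wd : WeierstrassCurve ℚ) [Wd.IsElliptic] [Wd.IsGloballyMinimal] (p : ℕ) [Fact p.Prime],
        ClassX11a Wd p → Surj Wd p → ¬ X11a.ShaAnUnit Wd p → MissingLowerBoundAt Wd p := by
  constructor
  · intro h W _ _ p _ hX hs _
    exact h W p hX hs
  · intro h W _ _ p _ hX hs
    by_cases hu : X11a.ShaAnUnit W p
    · exact missingLowerBoundAt_of_shaAnUnit W p hu
    · exact h W p hX hs hu

/-- The registered birth stub `stub_lowerNonSurj` (c998db5e) is EQUIVALENT to its off-unit restriction
`stub_lowerNonSurjDeep` (pure logic). [cite: Miller2011LMS, Def. 1.1] -/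
theorem stub_lowerNonSurj_iff_deep :
    (∀ (Wd : WeierstrassCurve ℚ) [Wd.IsElliptic] [Wd.IsGloballyMinimal] (p : ℕ) [Fact p.Prime],
        ClassX11a Wd p → ¬ Surj Wd p → MissingLowerBoundAt Wd p) ↔
      ∀ (Wd : WeierstrassCurve ℚ) [Wd.IsElliptic] [Wd.IsGloballyMinimal] (p : ℕ) [Fact p.Prime],
        ClassX11a Wd p → ¬ Surj Wd p → ¬ X11a.ShaAnUnit Wd p → MissingLowerBoundAt Wd p := by
  constructor
  · intro h W _ _ p _ hX hs _
    exact h W p hX hs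
  · intro h W _ _ p _ hX hs
    by_cases hu : X11a.ShaAnUnit W p
    · exact missingLowerBoundAt_of_shaAnUnit W p hu
    · exact h W p hX hs hu

/-! ## The composition (sorry-free): the stub STATEMENTS imply the crux, BY NAME -/

/-- **Composition (real proof, stubs applied BY NAME; r19 — byte-identical at r20, where the five fact names are PROJECTIONS of the ONE cite stub `stub_printInputsLower`)**: the WHOLE crux body from the seven registered stubs — width seat er5-p2 g14's
`Theorems.GreenbergRankZero.x11aLowerHalf_of_lowerAtThree_of_mazurMCAtDeepFive_of_greenberg_of_threeFacts` (p666636, REF V103 PASS): an X11a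
prime is odd, so `p = 3 ∨ 5 ≤ p`; `p = 3` ⟵ item 23178's text `stub_x11aLowerHalfAtThree`; `p ≥ 5`: unit pairs free, deep pairs (both images) ⟵
Mazur's statement at the pair (`stub_mazurMCAtDeepFive`) through the Greenberg-typed five-fact door
`ClassX11a.missingLowerBoundAt_of_mazurMainConjectureAt_of_greenberg` — modularity (`stub_newformFact`), Greenberg's rank-`0` formula at a split ∕
non-split prime (`stub_greenbergSplitRankZero` ∕ `stub_greenbergNonsplitRankZero`; the INPUT seats' slices p662964 ∕ p664420 inside), GZK
(`stub_gzkFactLower`), Greenberg–Stevens at the (odd) prime (`stub_greenbergStevensOdd`); NO Stein–Wuthrich 6.1, NO Kato instance, NO chain ∕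
partner fact.  Concludes the crux decl `Theses.ErratumRoadFive.X11aLowerHalf` (= `Theses.PrintX11a.X11aLowerHalf`, the same term: both route
defs have one body, `Iff.rfl`) BY NAME; no `sorry` of its own; the W-81′ booking glue IS this theorem (`X11aLowerHalf_holds :=
Theorems.GreenbergRankZero.x11aLowerHalf_of_lowerAtThree_of_mazurMCAtDeepFive_of_greenberg_of_threeFacts C_23178 C_19382 C_G104 C_G103 C_19921
C_GSodd C_MC5`).  [cite: GreenbergLNM1716, §4, the passage following Thm. 4.1 (pp. 111–113)] [cite: Miller2011LMS, Def. 1.1]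
[cite: MazurTateTeitelbaum1986Invent, §I.14 (shape only)] [cite: Skinner2016PacificMC, Thm. A (shape only)] -/
theorem X11aLowerHalf_of :
    Summit.BirchSwinnertonDyer.BirchSwinnertonDyer.Theses.ErratumRoadFive.X11aLowerHalf :=
  Summit.BirchSwinnertonDyer.BirchSwinnertonDyer.Theorems.GreenbergRankZero.x11aLowerHalf_of_lowerAtThree_of_mazurMCAtDeepFive_of_greenberg_of_threeFacts
    stub_x11aLowerHalfAtThree stub_newformFact stub_greenbergSplitRankZero stub_greenbergNonsplitRankZero stub_gzkFactLower
    stub_greenbergStevensOdd stub_mazurMCAtDeepFive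

/-- The same composition concluding the `PrintX11a` spelling of the crux BY NAME (the two route decls are
the same statement: `Iff.rfl`, REF g12 `LinePolice19064` P1). [cite: Miller2011LMS, Def. 1.1] -/
theorem X11aLowerHalf_of_printX11a :
    Summit.BirchSwinnertonDyer.BirchSwinnertonDyer.Theses.PrintX11a.X11aLowerHalf :=
  X11aLowerHalf_of

/-! ## The r18 road — KEPT IN THE TREE, not restated here

The r10–r18 registered text `stub_nineFactsOddGS` (SW-typed nine) closes L together with `stub_x11aLowerHalfAtThree`, `stub_gzkFactLower`,
`stub_mazurMCAtDeepFive` through the lead's LANDED four-children theorem `Theorems.Birth.x11aLowerHalf_erratumRoadFive_of_lowerAtThree_of_children_r18`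
∕ `…x11aLowerHalf_of_lowerAtThree_of_children_r18` (p663752, sorry-free; W-81′ turnkey `… C_23178 C_nine C_19921 C_MC5`), so a planner who files the
SW-typed nine (for U3's r6 road) still closes L by name; r19 loses no road.  (Not restated in this workfile: a theorem concluding a route decl under an
unregistered conjunction hypothesis would be read as the skeleton by the A12 audit when policed under the `ErratumRoadFive` spelling.) -/

end Summit.BirchSwinnertonDyer.BirchSwinnertonDyer.Cruxes.X11aLowerHalf.Birth

end
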